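import Summits.PneNP.PneNP.Theses.OneSlice
import Summits.PneNP.PneNP.Theorems.SingleThreshold.Negative.LoadBearing
import Summits.PneNP.PneNP.Theorems.OneSliceSingleThresholdStructuralApprox
import Summits.PneNP.PneNP.Theorems.OneSliceSingleThresholdExactCliqueDescent
import Summits.PneNP.PneNP.Theorems.OneSliceSingleThresholdTwoRoundTransfer
import Summits.PneNP.PneNP.Theorems.OneSliceSingleThresholdCliqueMinusEdgeInvisible
import Summits.PneNP.PneNP.Theorems.OneSliceSingleThresholdDoseTransfer
import Summits.PneNP.PneNP.Theorems.OneSliceSingleThresholdGnpTVSprinkle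
import Summits.PneNP.PneNP.Theorems.OneSliceSingleThresholdBackgroundMonotone
import Summits.PneNP.PneNP.Theorems.OneSliceSingleThresholdDoseInvisibleBeyondWindow
import Summits.PneNP.PneNP.Theorems.OneSliceSingleThresholdDoseTrivialBelowCritical
import Summits.PneNP.PneNP.Theorems.OneSliceSingleThresholdAdvLeReads
import Summits.PneNP.PneNP.Theorems.OneSliceSingleThresholdPlantedApproxError
import Summits.PneNP.PneNP.Theorems.OneSliceSingleThresholdTwoRoundTransferSharp
import Literature.Computability.Complexity.RossmanMonotoneCliqueThm2Proofs
import Literature.Computability.Complexity.RossmanMonotoneCliqueFinite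
import Literature.Computability.Complexity.GnpSprinkling
import Literature.Computability.Complexity.RossmanMonotoneCliqueLemma23Proofs
import Literature.Computability.Complexity.CliqueThresholdBounds

/-!
# Line `two-round-exposure` for crux `SingleThreshold` (stmt-PneNP-2833) — lead c3's skeleton v6
(exact-clique descent + sparse-dose dial + background dial; split ⟹ pair-leak)

v6 (lead prover-line-stmt-PneNP-2833-c3-0, 2026-08-17) = c2's v5 with stub K `stub_doseTrivialBelowCritical`
LINKED to its landed tree theorem (`…Theorems.SingleThreshold.stub_doseTrivialBelowCritical`, p140515), so the
`sorry`s left are exactly: the three needle costumes E `stub_descentSplit`, E′ `stub_relativeSparseDose`,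
I `stub_noisyIndistSparse` (held by the lead); the calibration stub L `stub_plantedApproxError` was waved
and LANDED (p141374, linked). Docstring of K updated ("LANDED"). NEW calibration stub M `stub_advLeReads` (the needles hold below
`n²` gates, by locality: `noisyIndist_matrix_le_one`), LANDED p141207 and linked. v6.2: NEW stub A′
`stub_twoRoundTransferSharp` (exponent-exact lever, LANDED p142224, linked) and the needle in its cleanest costume
N `stub_noisyIndist` (size ≤ n^c + 1) with glue `noisyIndist_of_descentSplit` (E ⟹ N) and
`SingleThreshold_of_noisyIndist` (A′ ∘ N closes the crux at the SAME exponent); the only `sorry`s are E, E′, I, N.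

v5 (lead prover-line-stmt-PneNP-2833-c2-0, 2026-08-17) = c1's v4 with: stubs C, D, H, J LINKED to their
landed tree theorems (`…Theorems.SingleThreshold.stub_structuralApprox` p81105, `…stub_exactCliqueDescent`
p83017, `…stub_backgroundMonotone` p124662, `…stub_doseInvisibleBeyondWindow` p124693 — the farm builds all
four modules now), so the only `sorry`s left are the three needle costumes E `stub_descentSplit`,
E′ `stub_relativeSparseDose`, I `stub_noisyIndistSparse` and the two provable calibration stubs K
`stub_doseTrivialBelowCritical`, L `stub_plantedApproxError` (waved this cycle); NEW sorry-free glue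
`split_leaky` / `pairLeak_of_descentSplit`: at the terminal `∧`-gate of an exact-clique descent BOTH
children reject the background and accept some `K_A − e` (stub B's event twice), so the needle E is the
statement that a live path from the output to a doubly-leaky `∧`-gate has vanishing probability.

v4 (lead prover-line-stmt-PneNP-2833-c1-0, 2026-08-16) = the previous lead's v3.2 with
* stubs A–D, F, G LINKED to their landed tree theorems (one-line wrappers, no `sorry`):
  `Summit.PneNP.PneNP.Theorems.SingleThreshold.stub_structuralApprox` (p81105),
  `…stub_exactCliqueDescent` (p83017), `…stub_twoRoundTransfer` (p85456),
  `…stub_cliqueMinusEdgeInvisible` (p92189), `…stub_doseTransfer` (p93385), `…stub_gnpTVSprinkle` (p93648);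
* OPEN needles (crux-hard, held by the lead): E′ `stub_relativeSparseDose` (critical path of the registered
  composition `SingleThreshold_of`), E `stub_descentSplit` (strong form, `SingleThreshold_of_descentSplit`),
  and NEW I `stub_noisyIndistSparse` (NoisyIndist at a FIXED, `k`-independent background density `n^{-β}`,
  composition `SingleThreshold_of_nis`);
* NEW provable stubs (wave of cycle 1): H `stub_backgroundMonotone` (NoisyIndist is monotone in the
  background density — the transfer behind `SingleThreshold_of_nis`), J `stub_doseInvisibleBeyondWindow`
  (TV(G(n,q ⊕ n^{-σ}), G(n,q)) → 0 for σ > 1 + (1+ε)/(k−1): the dial is FLAT beyond the window,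
  `adv_le_rsd_beyond_window`), K `stub_doseTrivialBelowCritical` (a planted `k`-clique is invisible in the
  supercritical dose G(n,n^{-σ}), σ < 2/(k−1): the dial is TRIVIAL below `2/(k−1)`, `rsd_trivial_below_critical`),
  L `stub_plantedApproxError` (Lemma 13 holds under the PLANTED law too: the ⋆-approximation loses nothing on
  either side, `adv_approx_ge`).

Route `OneSlice` (route-PneNP-OneSlice); crux `Summit.PneNP.PneNP.Theses.OneSlice.SingleThreshold`
(Rossman's single-threshold problem, unbounded-exponent form: `∀ c ∃ k ≥ 3 ∃ δ > 0 ∀ᶠ n`, every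
monotone `{∧₂,∨₂}`-circuit that is `δ`-accurate for `k`-CLIQUE on `G(n, n^{-2/(k-1)})` has more than
`n^c` gates). Planner skeleton `Lines/two-round-exposure.lean` (crux-plan round 1), reshaped by lead
prover-line-stmt-PneNP-2833-0 (v1–v3.2, `Lines/two_round_exposure.lean`) — SAME composition idea
(two-round exposure ⇒ NoisyIndist ⇒ crux, same registered transfer `stub_twoRoundTransfer`).

**Idea.** Expose the critical graph in two rounds, `G(n,p) = H' ∪ S`, `S ∼ G(n,q)`,
`q = pMinus k ε n = n^{-2(1+ε)/(k-1)}` subcritical; the restriction `C^{H'}` of a small accurate `C`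
tells `S ∪ K_A` from `S` with constant advantage (`stub_twoRoundTransfer`, the lever, as filed and
triaged). NoisyIndist (no size-`n^c` monotone01 circuit has advantage `γ`, eventually, every `γ > 0`)
is decomposed along the EXACT CLIQUE MINTERM:
* for every MONOTONE `f`: `{f(S ∪ K_A) = 1, f(S) = 0} ⊆ {K_A is an exact minterm of f_S := f(S ∪ ·)}
  ∪ {f(S) = 0 ∧ ∃ e ∈ K_A, f(S ∪ (K_A − e)) = 1}` (contrapositive of `isMinterm_of_forall_update`);
  the second event has probability `≤ n^{-c₁}` because planting a `k`-clique MINUS AN EDGE at a random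
  position into `S` is invisible (second moment; every proper subgraph of `K_k` is strictly
  supercritical in `S` for `ε ≤ k⁻³`) — `stub_cliqueMinusEdgeInvisible`;
* pass from the circuit `D` to the structural ⋆-closed approximation `f̄` of its `{∧₂,∨₂}`-program
  (`stub_structuralApprox`): `D ≤ f̄` and Lemma 13 (and, NEW, Lemma 13 under planting: `stub_plantedApproxError`,
  so `adv(D) = adv(f̄) ± o(1)` — the needle for approximators IS the needle for circuits);
* the EXACT clique minterm of `f̄_S` DESCENDS: through `∨̄ = (· ∨ ·)⋆`-gates for free (a closure-added
  `H ∈ I ∪ J` has `< k` non-isolated vertices, so it cannot carry `K_A`), through an `∧`-gate unless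
  `K_A = M₁ ∪ M₂` SPLITS into two PROPER shifted minterms of the children; input wires never carry it
  (`k ≥ 3`) — `stub_exactCliqueDescent` (deterministic);
* NEEDLE `stub_descentSplit`: a split at the end of an exact-clique descent from the output has
  vanishing probability for programs of length `≤ n^c`, `k ≥ k₀(c)`, `ε ≤ ε₀(k)` (≡ NoisyIndist for
  approximators; Rossman FOCS'10 §9 in this costume; the path condition is load-bearing: `n^{4.1}` junk
  gates `T_{θ₁}(E₁) ∧ T_{θ₂}(E₂)` each split w.p. `≈ 2/(Nq)`).
* DIALS. (dose) `SingleThreshold ⟸ RSD_σ` for one `σ > 1 + 1/(k−1)` (stubs F, G landed; needle E′); the dose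
  dial is trivial below `2/(k−1)` (K), Theorem-1-level at `σ < 1/(2(c+2))` pointwise (Literature
  `rsd_at_sparse_dose`, p119747), and flat (= NoisyIndist) beyond the window `σ > 1 + (1+ε)/(k−1)` (J).
  (background, NEW) NoisyIndist at background density `q_b` implies it at every `q ≥ q_b` for circuits one gate
  smaller (H: the first of two independent background rounds is absorbed into the circuit by restriction), so the
  needle may be posed at ANY fixed background density `n^{-β}`, `β = β(c) > 0` independent of `k`
  (needle I, `stub_noisyIndistSparse`; expected truth range `β < ~1/(2c)`: beyond it size-`n^c` circuits see
  cliques absent from the background).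

No definitions in this file (statements inlined over tree vocabulary: `gnpWeight`, `gnpProb`, `kSubsetProb`,
`cliqueVec`, `pMinus`, `tThr`, `smallI`, `medJ`, `IsMinterm`, `starClosure`, `StarApproxInv`,
`GateList.WF/OutOK/andGate/orGate/vals`, `Circuit`, `monotoneBasis(01)`, `Edges` from the landed
`Negative/LoadBearing.lean`).
-/

noncomputable section

set_option linter.dupNamespace false

open Finset Filter
open scoped Classical Topology

namespace Summit.PneNP.PneNP.Cruxes.SingleThreshold.TwoRoundExposure

open Literature.Computability.Complexity GateList
open Summit.PneNP.PneNP.Theorems.SingleThreshold.Negative (Edges gnpProb_union_le pc)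

/-! ## Registered stubs (A, A′, B, C, D, F, G, H, J, K, L, M LANDED and linked; E, E′, I, N = the needle) -/

/-- **Stub A — two-round transfer (THE LEVER; verbatim from the planner skeleton; LANDED p85456).**
`NoisyIndist(c+1) → crux body(c)` at the same `k`: given `c, k ≥ 5, ε > 0`, if NO monotone
`{∧₂,∨₂,0,1}`-circuit of size `≤ n^{c+1}` distinguishes `S ∪ K_A` from `S` (`S ∼ G(n, pMinus k ε n)`,
`A` a uniform `k`-set) with advantage `γ`, eventually in `n`, for every `γ > 0`, then
`∃ δ > 0 ∀ᶠ n ∀ C` monotone, `err_p(C) ≤ δ → n^c < |C|` (`p = n^{-2/(k-1)}`). Proof sketch: union law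
`sum_sum_gnpWeight_mul_sup` with `p₁ = (p-q)/(1-q)`; for a `δ`-accurate monotone `C` of size `≤ n^c`,
`Pr_{G,A}[C(G ∪ K_A)=1] - Pr_G[C(G)=1] ≥ Pr[ω_k=0] - δ - δ/Pr[ω_k=1] - TV₂₃ ≥ c₀(k)/2` for `δ ≤ δ₀(k)`
(`sum_cliqueFree_mul_kSubsetProb_false_le`, `Rossman2010_plantedVsConditioned_holds`,
`eventually_le_gnpProb_cliqueFree`, `eventually_le_gnpProb_cliqueCount_eq_one`), and the left side is the
`H'`-average of the advantages of `C^{H'}` (`Circuit.exists_restrict_sup`, size `≤ n^c + 1 ≤ n^{c+1}`),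
each `≤ γ = c₀/4` eventually — contradiction. The bookkeeping of `Rossman2010_twoThresholds_of_thm1_lemma23`
with `H'` for `H`. [cite: Rossman2010, §7 and App. B (pp. 10, 13–14)] -/
theorem stub_twoRoundTransfer :
    ∀ (c k : ℕ) (ε : ℝ), 5 ≤ k → 0 < ε →
      (∀ γ : ℝ, 0 < γ →
      ∀ᶠ n : ℕ in atTop, ∀ D : Circuit (⊤ : SimpleGraph (Fin n)).edgeSet,
        D.IsOver monotoneBasis01 → D.size ≤ n ^ (c + 1) →
          (∑ x : ((⊤ : SimpleGraph (Fin n)).edgeSet → Bool),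
              gnpWeight n (pMinus k ε n) x *
                kSubsetProb n k (fun A => D.eval (x ⊔ cliqueVec A) = true)) -
            gnpProb n (pMinus k ε n) (univ.filter fun x => D.eval x = true) ≤ γ) →
      ∃ δ : ℝ, 0 < δ ∧ ∀ᶠ n : ℕ in Filter.atTop,
        ∀ C : Literature.Computability.Complexity.Circuit ((⊤ : SimpleGraph (Fin n)).edgeSet),
          C.IsOver Literature.Computability.Complexity.monotoneBasis →
            (Finset.univ.filter (fun x : ((⊤ : SimpleGraph (Fin n)).edgeSet) → Bool =>
                C.eval x ≠ decide (¬ (SimpleGraph.fromEdgeSet {e : Sym2 (Fin n) |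
                  ∃ h : e ∈ (⊤ : SimpleGraph (Fin n)).edgeSet, x ⟨e, h⟩ = true}).CliqueFree k))).sum
              (fun x => ((n : ℝ) ^ (-(2 : ℝ) / ((k : ℝ) - 1))) ^ (Finset.univ.filter (fun e => x e = true)).card *
                (1 - (n : ℝ) ^ (-(2 : ℝ) / ((k : ℝ) - 1))) ^
                  (n.choose 2 - (Finset.univ.filter (fun e => x e = true)).card)) ≤ δ →
            n ^ c < C.size :=
  _root_.Summit.PneNP.PneNP.Theorems.SingleThreshold.stub_twoRoundTransfer

/-- **Stub B — a planted clique minus an edge is invisible (LANDED p92189).** For `k ≥ 5`,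
`0 < ε ≤ k⁻³` there is `c₁ > 0` such that eventually in `n`, for every MONOTONE `f`:
`Pr_{S,A}[f(S) = 0 ∧ ∃ e ∈ K_A, f(S ∪ (K_A − e)) = 1] ≤ n^{-c₁}` (`S ∼ G(n, pMinus k ε n)`, `A` a
uniform `k`-set). Why true: by monotonicity and a union bound over the `C(k,2)` edges the left side is
`≤ (1/C(n,k)) Σ_{(A,e)} (E_S f(S ∪ (K_A−e)) − E_S f(S)) = C(k,2)·(E f(S ∪ Q) − E f(S))` for the planted
family `Q = K_A − e`, `(A, e)` uniform; its likelihood ratio `L(z) = E_{(A,e)} q^{-|Q|}[Q ⊆ z]` has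
`E_S L² − 1 = E_{(A,e),(A',e')}[q^{-|Q ∩ Q'|} − 1] ≤ Σ_{j=2}^{k-1} Pr[|A∩A'|=j]·q^{-C(j,2)} + Pr[A=A']·q^{-(C(k,2)-1)}`
`≤ O_k(n^{-2+2(1+ε)/(k-1)} + n^{-(1-ε(k-2))} + n^{-(2(1+ε)/(k-1) − εk)}) → 0` (every proper subgraph
of `K_k` is strictly supercritical in `S` for `ε ≤ k⁻³`), and `|E_planted f − E f| ≤ √(E L² − 1)`;
`c₁ = 1/(4k)` works. (General form, same proof: any family `A ↦ Q_A < cliqueVec A`; the planner's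
`stub_smallPattern` is the sub-case `2·supp(Q_A) < k`.) [cite: Rossman2010, Lemma 23 (App. B) for the
second-moment template; folklore] -/
theorem stub_cliqueMinusEdgeInvisible :
    ∀ k : ℕ, 5 ≤ k → ∀ ε : ℝ, 0 < ε → ε ≤ 1 / (k : ℝ) ^ 3 → ∃ c₁ : ℝ, 0 < c₁ ∧
      ∀ᶠ n : ℕ in atTop, ∀ f : (Edges n → Bool) → Bool, Monotone f →
        (∑ x : Edges n → Bool, gnpWeight n (pMinus k ε n) x *
            kSubsetProb n k (fun A => f x = false ∧
              ∃ e, cliqueVec A e = true ∧ f (x ⊔ Function.update (cliqueVec A) e false) = true))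
          ≤ (n : ℝ) ^ (-c₁) :=
  _root_.Summit.PneNP.PneNP.Theorems.SingleThreshold.stub_cliqueMinusEdgeInvisible

/-- **Stub C — the structural ⋆-closed approximation (verbatim the stub `stub_structuralApprox` of line
self-noise-closure; LANDED p81105).** For a bias `0 ≤ p ≤ 1`, a trigger `0 ≤ t < 1 − p`
and classes `I, J` with all single-coordinate vectors in `I` and `I ⊔ I ⊆ I ∪ J`, every well-formed
`{∧₂,∨₂}`-program `gs` has wire approximators `ap` which are (a) exact on inputs, (b) exact conjunctions
at `∧`-gates, (c) the ⋆-closure (w.r.t. `(p, t, I ∪ J)`) of the disjunction at `∨`-gates, and (d) satisfy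
`StarApproxInv` (monotone, ⋆-closed, dominating, Lemma 13 error, Lemma 14 locality). Why true: the
induction of the tree's `exists_closedApprox` (`StarApproxInv.nil` / `.snoc`) with the construction,
which that proof performs but does not export, recorded in the conclusion; earlier wires keep their
approximators when a gate is appended (`getD_vals_append_cons`), and every gate over `monotoneBasis` is
an `andGate` or an `orGate` (`exists_eq_andGate_of_fn_eq` / `exists_eq_orGate_of_fn_eq`).
[cite: Rossman2010, §5.2, Lemmas 13–14 (p. 8)] -/
theorem stub_structuralApprox {ι : Type*} [Fintype ι] [DecidableEq ι] {p t : ℝ}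
    (hp0 : 0 ≤ p) (hp1 : p ≤ 1) (ht : 0 ≤ t) (htp : t < 1 - p)
    {I J : Finset (ι → Bool)} (hI1 : ∀ i, indVec {i} ∈ I)
    (hIJ : ∀ x ∈ I, ∀ y ∈ I, x ⊔ y ∈ I ∪ J)
    (gs : List (Gate ι)) (hwf : GateList.WF gs) (hB : ∀ g ∈ gs, g.fn ∈ monotoneBasis) :
    ∃ ap : ι ⊕ ℕ → (ι → Bool) → Bool,
      (∀ i, ap (Sum.inl i) = fun x => x i) ∧
      (∀ (m : ℕ) (u v : ι ⊕ ℕ), gs[m]? = some (GateList.andGate u v) →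
          ap (Sum.inr m) = fun x => ap u x && ap v x) ∧
      (∀ (m : ℕ) (u v : ι ⊕ ℕ), gs[m]? = some (GateList.orGate u v) →
          ap (Sum.inr m) = starClosure p t (I ∪ J) (fun x => ap u x || ap v x)) ∧
      StarApproxInv p t I J gs ap :=
  _root_.Summit.PneNP.PneNP.Theorems.SingleThreshold.stub_structuralApprox hp0 hp1 ht htp hI1 hIJ gs hwf hB

/-- **Stub D — the exact clique minterm descends to a split (deterministic; LANDED p83017).**
For the structural approximators `ap` of a `{∧₂,∨₂}`-program `gs` (clauses (a)–(c) of stub C, any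
bias/trigger, classes `smallI ∪ medJ`), a background `x` and a `k`-set `A` (`k ≥ 3`): if `K_A` is an
exact minterm of the shifted output `y ↦ ap out (x ⊔ y)`, then there is a descent `out = w₀, …, w_r`
(each `w_{i+1}` a child of the gate `w_i`) along which `K_A` stays an exact minterm of every shifted
approximator, ending at an `∧`-gate `w_r = u ∧ v` at which `K_A` is an exact shifted minterm of
neither child (a SPLIT: `K_A = M₁ ∪ M₂` with proper shifted minterms, `IsMinterm.of_and`). Why true
(induction on the wire, `WF`): an input wire `y ↦ (x ⊔ y) i` is constant or has the single minterm
`indVec {i} ≠ cliqueVec A` (`#A ≥ 3`); at an `∨`-gate, a minterm `m₀` of `y ↦ (g ∨ ⋁_{h} Ind_h)(x ⊔ y)`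
is a minterm of `y ↦ g (x ⊔ y)` or satisfies `m₀ ≤ h` for an added `h` (take `y = m₀ ⊓ h`), and
`h ∈ smallI ∪ medJ` has `#supp h ≤ k − 1 < k = #supp (cliqueVec A)` (`mem_smallI`, `medJ_ineq`,
`supp_cliqueVec`, `supp_mono`) — so `K_A` descends to `u` or `v` (`IsMinterm.of_or`); at an `∧`-gate
it descends or splits by definition. [cite: Rossman2010, Observation 7 and Lemma 14 (pp. 6, 8); this line] -/
theorem stub_exactCliqueDescent {n k : ℕ} (hk : 3 ≤ k) {p t : ℝ}
    (gs : List (Gate (Edges n))) (ap : Edges n ⊕ ℕ → (Edges n → Bool) → Bool)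
    (hwf : GateList.WF gs) (hB : ∀ g ∈ gs, g.fn ∈ monotoneBasis)
    (hinl : ∀ i, ap (Sum.inl i) = fun x => x i)
    (hand : ∀ (m : ℕ) (u v : Edges n ⊕ ℕ), gs[m]? = some (GateList.andGate u v) →
        ap (Sum.inr m) = fun x => ap u x && ap v x)
    (hor : ∀ (m : ℕ) (u v : Edges n ⊕ ℕ), gs[m]? = some (GateList.orGate u v) →
        ap (Sum.inr m) = starClosure p t (smallI n k ∪ medJ n k) (fun x => ap u x || ap v x))
    (hmono : ∀ w, GateList.OutOK gs.length w → Monotone (ap w))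
    (x : Edges n → Bool) (A : Finset (Fin n)) (hA : #A = k)
    (out : Edges n ⊕ ℕ) (hout : GateList.OutOK gs.length out)
    (hmin : IsMinterm (fun y => ap out (x ⊔ y)) (cliqueVec A)) :
    ∃ (r m : ℕ) (u v : Edges n ⊕ ℕ) (w : ℕ → Edges n ⊕ ℕ),
      w 0 = out ∧ w r = Sum.inr m ∧ gs[m]? = some (GateList.andGate u v) ∧
      (∀ i, i < r → ∃ (m' : ℕ) (u' v' : Edges n ⊕ ℕ), w i = Sum.inr m' ∧
          (gs[m']? = some (GateList.andGate u' v') ∨ gs[m']? = some (GateList.orGate u' v')) ∧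
          (w (i + 1) = u' ∨ w (i + 1) = v')) ∧
      (∀ i, i ≤ r → IsMinterm (fun y => ap (w i) (x ⊔ y)) (cliqueVec A)) ∧
      ¬ IsMinterm (fun y => ap u (x ⊔ y)) (cliqueVec A) ∧
      ¬ IsMinterm (fun y => ap v (x ⊔ y)) (cliqueVec A) :=
  _root_.Summit.PneNP.PneNP.Theorems.SingleThreshold.stub_exactCliqueDescent hk gs ap hwf hB hinl hand hor
    hmono x A hA out hout hmin

/-- **Stub E — DescentSplit (OPEN — the NEEDLE; hardest stub).** For every exponent `c` there is
`k₀` such that for all `k ≥ k₀` and all small `ε`: for every well-formed `{∧₂,∨₂}`-program `gs` of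
length `≤ n^c`, output wire `out`, and its STRUCTURAL ⋆-closed approximation `ap` at the sprinkle bias
`q = pMinus k ε n` (inputs exact, `∧` exact, `∨ ↦ (·∨·)⋆` w.r.t. `(q, tThr ε n, smallI ∪ medJ)`, hence
`StarApproxInv`), the probability over `(S, A)` (`S ∼ G(n,q)`, `A` a uniform `k`-set) that there is a
descent `out = w₀ → … → w_r` along which `K_A` is an EXACT minterm of every shifted approximator
`y ↦ ap (w i) (S ∪ y)`, ending at an `∧`-gate `w_r = u ∧ v` where `K_A` SPLITS (is an exact shifted
minterm of neither child), is eventually `≤ γ`, for every `γ > 0`. Why this is exactly what is left: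
by stubs B–D every other way for the closed approximator to distinguish `S ∪ K_A` from `S` has
vanishing probability, so the statement is equivalent (modulo B–D and Lemma 13) to NoisyIndist for the
programs' approximators, and it implies the crux through stub A. Why plausibly true: the event is
contained in the flip `{f̄(S ∪ K_A) = 1, f̄(S) = 0}` whose probability is the advantage of `f̄`; a PURE
threshold never splits (its shifted minterms are all `r`-sets, so `K_A` is a shifted minterm of one child
or of none); a split needs two complementary LOCALISATIONS of `K_A` in the two children (e.g.
`T_{θ₁}(E₁) ∧ T_{θ₂}(E₂)`, `E₁ ⊔ E₂` = all slots: rate `≈ 2/(Nq) = n^{-2+2(1+ε)/(k-1)}` per gate). Why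
it is hard: that per-gate rate makes the union bound over gates work exactly for `c < 2 − 2/(k−1)` (the
locality range of `Negative/Locality.lean`), and `n^{4.1}` junk split gates make the PATH-FREE version
false for `c ≥ 5`, so the proof must charge splits to the output along the descent (Rossman FOCS'10 §9,
the open single-threshold problem, in this costume; no catalogued barrier applies: monotone, average
case; `ApproximationMethodLimit` is for complete bases). [cite: Rossman2010, §9 (p. 11); this crux's
Lines/two-round-exposure.md, TRIAGE-r1-1..3] -/
theorem stub_descentSplit :
    ∀ c : ℕ, ∃ k₀ : ℕ, ∀ k : ℕ, k₀ ≤ k → ∃ ε₀ : ℝ, 0 < ε₀ ∧ ∀ ε : ℝ, 0 < ε → ε ≤ ε₀ →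
      ∀ γ : ℝ, 0 < γ → ∀ᶠ n : ℕ in atTop,
        ∀ (gs : List (Gate (Edges n))) (out : Edges n ⊕ ℕ)
          (ap : Edges n ⊕ ℕ → (Edges n → Bool) → Bool),
          GateList.WF gs → (∀ g ∈ gs, g.fn ∈ monotoneBasis) → gs.length ≤ n ^ c →
          GateList.OutOK gs.length out →
          (∀ i, ap (Sum.inl i) = fun x => x i) →
          (∀ (m : ℕ) (u v : Edges n ⊕ ℕ), gs[m]? = some (GateList.andGate u v) →
              ap (Sum.inr m) = fun x => ap u x && ap v x) →
          (∀ (m : ℕ) (u v : Edges n ⊕ ℕ), gs[m]? = some (GateList.orGate u v) →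
              ap (Sum.inr m) =
                starClosure (pMinus k ε n) (tThr ε n) (smallI n k ∪ medJ n k)
                  (fun x => ap u x || ap v x)) →
          StarApproxInv (pMinus k ε n) (tThr ε n) (smallI n k) (medJ n k) gs ap →
            (∑ x : Edges n → Bool, gnpWeight n (pMinus k ε n) x * kSubsetProb n k (fun A =>
                ∃ (r m : ℕ) (u v : Edges n ⊕ ℕ) (w : ℕ → Edges n ⊕ ℕ),
                  w 0 = out ∧ w r = Sum.inr m ∧ gs[m]? = some (GateList.andGate u v) ∧
                  (∀ i, i < r → ∃ (m' : ℕ) (u' v' : Edges n ⊕ ℕ), w i = Sum.inr m' ∧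
                      (gs[m']? = some (GateList.andGate u' v') ∨
                        gs[m']? = some (GateList.orGate u' v')) ∧
                      (w (i + 1) = u' ∨ w (i + 1) = v')) ∧
                  (∀ i, i ≤ r → IsMinterm (fun y => ap (w i) (x ⊔ y)) (cliqueVec A)) ∧
                  ¬ IsMinterm (fun y => ap u (x ⊔ y)) (cliqueVec A) ∧
                  ¬ IsMinterm (fun y => ap v (x ⊔ y)) (cliqueVec A))) ≤ γ := by
  sorry

/-! ## Glue lemmas (sorry-free) -/

/-- Shifting preserves monotonicity: `y ↦ f (x ⊔ y)` is monotone for monotone `f`. [folklore] -/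
theorem monotone_shift {n : ℕ} {f : (Edges n → Bool) → Bool} (hf : Monotone f) (x : Edges n → Bool) :
    Monotone fun y => f (x ⊔ y) :=
  fun _ _ h => hf (sup_le_sup_left h x)

/-- **The exact-minterm decomposition of the flip** (contrapositive of `isMinterm_of_forall_update`):
for monotone `f`, if `f (x ∪ K_A) = 1` then either `K_A` is an exact minterm of `y ↦ f (x ∪ y)` or some
`K_A − e` is already accepted on top of `x`. [folklore] -/
theorem isMinterm_or_exists_update {n : ℕ} {f : (Edges n → Bool) → Bool} (hf : Monotone f)
    (x : Edges n → Bool) (A : Finset (Fin n)) (h1 : f (x ⊔ cliqueVec A) = true) :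
    IsMinterm (fun y => f (x ⊔ y)) (cliqueVec A) ∨
      ∃ e, cliqueVec A e = true ∧ f (x ⊔ Function.update (cliqueVec A) e false) = true := by
  by_cases h : ∃ e, cliqueVec A e = true ∧ f (x ⊔ Function.update (cliqueVec A) e false) = true
  · exact Or.inr h
  · left
    push Not at h
    refine isMinterm_of_forall_update (monotone_shift hf x) h1 fun e he => ?_
    have := h e he
    simpa using this

/-- **Advantage ≤ exact-minterm mass + minus-an-edge mass**, pointwise in the background `x`, for a
monotone `f` (the `k`-sets are averaged by `kSubsetProb`; needs `k ≤ n` so that `Pr_A[True] = 1`).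
[folklore] -/
theorem kSubsetProb_flip_le {n k : ℕ} {f : (Edges n → Bool) → Bool} (hf : Monotone f)
    (x : Edges n → Bool) :
    kSubsetProb n k (fun A => f (x ⊔ cliqueVec A) = true) - (if f x = true then (1 : ℝ) else 0) ≤
      kSubsetProb n k (fun A => IsMinterm (fun y => f (x ⊔ y)) (cliqueVec A)) +
        kSubsetProb n k (fun A => f x = false ∧
          ∃ e, cliqueVec A e = true ∧ f (x ⊔ Function.update (cliqueVec A) e false) = true) := by
  have h0 := kSubsetProb_nonneg n k (fun A => IsMinterm (fun y => f (x ⊔ y)) (cliqueVec A))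
  have h0' := kSubsetProb_nonneg n k (fun A => f x = false ∧
    ∃ e, cliqueVec A e = true ∧ f (x ⊔ Function.update (cliqueVec A) e false) = true)
  by_cases hfx : f x = true
  · rw [if_pos hfx]
    have := kSubsetProb_le_one n k (fun A => f (x ⊔ cliqueVec A) = true)
    linarith
  · rw [if_neg hfx, sub_zero]
    have hfx' : f x = false := by simpa using hfx
    have h1 := kSubsetProb_le_add (n := n) (k := k) (fun A => f (x ⊔ cliqueVec A) = true)
      (fun A => IsMinterm (fun y => f (x ⊔ y)) (cliqueVec A))
    have h2 : kSubsetProb n k (fun A => f (x ⊔ cliqueVec A) = true ∧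
        ¬ IsMinterm (fun y => f (x ⊔ y)) (cliqueVec A)) ≤
        kSubsetProb n k (fun A => f x = false ∧
          ∃ e, cliqueVec A e = true ∧ f (x ⊔ Function.update (cliqueVec A) e false) = true) := by
      refine kSubsetProb_mono fun A hA => ⟨hfx', ?_⟩
      rcases isMinterm_or_exists_update hf x A hA.1 with h | h
      · exact absurd h hA.2
      · exact h
    linarith

/-- `Pr_q[f = 1] = Σ_x w_q(x)·[f x]`. [folklore] -/
theorem gnpProb_eq_sum_ite {n : ℕ} (q : ℝ) (f : (Edges n → Bool) → Bool) :
    gnpProb n q (univ.filter fun x => f x = true) =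
      ∑ x : Edges n → Bool, gnpWeight n q x * (if f x = true then (1 : ℝ) else 0) := by
  rw [gnpProb_filter]
  refine sum_congr rfl fun x _ => ?_
  split_ifs <;> simp

/-- **Advantage of a monotone `f` ≤ exact-minterm mass + minus-an-edge mass** (summed over the
background; `k ≤ n` is not needed). [folklore] -/
theorem adv_le_split_sum {n k : ℕ} {q : ℝ} (hq0 : 0 ≤ q) (hq1 : q ≤ 1)
    {f : (Edges n → Bool) → Bool} (hf : Monotone f) :
    (∑ x : Edges n → Bool, gnpWeight n q x * kSubsetProb n k (fun A => f (x ⊔ cliqueVec A) = true)) -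
        gnpProb n q (univ.filter fun x => f x = true) ≤
      (∑ x : Edges n → Bool, gnpWeight n q x *
          kSubsetProb n k (fun A => IsMinterm (fun y => f (x ⊔ y)) (cliqueVec A))) +
      (∑ x : Edges n → Bool, gnpWeight n q x * kSubsetProb n k (fun A => f x = false ∧
          ∃ e, cliqueVec A e = true ∧ f (x ⊔ Function.update (cliqueVec A) e false) = true)) := by
  rw [gnpProb_eq_sum_ite, ← sum_sub_distrib, ← sum_add_distrib]
  refine sum_le_sum fun x _ => ?_
  have hw := gnpWeight_nonneg hq0 hq1 x
  have h := kSubsetProb_flip_le (k := k) hf x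
  have := mul_le_mul_of_nonneg_left h hw
  linear_combination this

/-- `Pr[f = 1] ≤ Pr[g = 1] + Pr[f ≠ g]`. [folklore] -/
theorem gnpProb_true_le_add_ne {n : ℕ} {q : ℝ} (hq0 : 0 ≤ q) (hq1 : q ≤ 1)
    (f g : (Edges n → Bool) → Bool) :
    gnpProb n q (univ.filter fun x => f x = true) ≤
      gnpProb n q (univ.filter fun x => g x = true) + gnpProb n q (univ.filter fun x => f x ≠ g x) := by
  refine le_trans (gnpProb_mono hq0 hq1 ?_) (gnpProb_union_le hq0 hq1 _ _)
  intro x hx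
  simp only [mem_filter, mem_univ, true_and, mem_union] at hx ⊢
  by_cases hg : g x = true
  · exact Or.inl hg
  · right; rw [hx]; exact fun h => hg h.symm

/-- `kSubsetProb` is monotone in the event, tested on `k`-sets only. [folklore] -/
theorem kSubsetProb_mono_card {n k : ℕ} {P Q : Finset (Fin n) → Prop} [DecidablePred P]
    [DecidablePred Q] (h : ∀ A, #A = k → P A → Q A) : kSubsetProb n k P ≤ kSubsetProb n k Q := by
  unfold kSubsetProb
  refine div_le_div_of_nonneg_right ?_ (Nat.cast_nonneg _)
  exact_mod_cast card_le_card (fun A hA => by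
    rw [mem_filter] at hA ⊢
    exact ⟨hA.1, h A (mem_powersetCard.1 hA.1).2 hA.2⟩)

/-- **At a split both children are rejecting and leaky** (v5, lead c2; deterministic sharpening of
stub D's terminal gate). If `K_A` is an exact minterm of the shifted conjunction
`y ↦ f (x ⊔ y) ∧ g (x ⊔ y)` of two monotone functions but of neither shifted factor, then EACH factor
rejects the background `x` and accepts `x ⊔ (K_A − e)` for some edge `e` of `K_A` — the event of
stub B (`stub_cliqueMinusEdgeInvisible`) for `f` and for `g` simultaneously. Proof: if `f x = 1` then
`f (x ⊔ y) = 1` for all `y`, so the conjunction's shift equals `g`'s shift and `K_A` would be an exact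
minterm of the latter; hence `f x = 0`; as `f (x ⊔ K_A) = 1` and `K_A` is not an exact minterm of
`f`'s shift, some `K_A − e` is accepted (`isMinterm_or_exists_update`). Consequently the descent-split
event of stub E is contained in "there is an `∧`-gate both of whose children are leaky at `(x, A)`",
a SECOND-ORDER planted-invisibility event (see `descentSplit_le_pairLeak`). [folklore; this line, lead c2] -/
theorem split_leaky {n : ℕ} {f g : (Edges n → Bool) → Bool} (hf : Monotone f) (hg : Monotone g)
    (x : Edges n → Bool) (A : Finset (Fin n))
    (hmin : IsMinterm (fun y => f (x ⊔ y) && g (x ⊔ y)) (cliqueVec A))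
    (hnf : ¬ IsMinterm (fun y => f (x ⊔ y)) (cliqueVec A))
    (hng : ¬ IsMinterm (fun y => g (x ⊔ y)) (cliqueVec A)) :
    (f x = false ∧ ∃ e, cliqueVec A e = true ∧ f (x ⊔ Function.update (cliqueVec A) e false) = true) ∧
    (g x = false ∧ ∃ e, cliqueVec A e = true ∧ g (x ⊔ Function.update (cliqueVec A) e false) = true) := by
  have h1 : f (x ⊔ cliqueVec A) = true ∧ g (x ⊔ cliqueVec A) = true := by
    have := hmin.1; simpa [Bool.and_eq_true] using this
  -- if a factor accepts the background, the other factor carries the exact minterm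
  have hfx : f x = false := by
    by_contra hc
    rw [Bool.not_eq_false] at hc
    have hall : ∀ y, f (x ⊔ y) = true := fun y => by
      have := hf (le_sup_left : x ≤ x ⊔ y); rw [hc] at this; exact top_le_iff.1 this
    refine hng ⟨h1.2, fun y hy => ?_⟩
    have := hmin.2 y hy
    simpa [hall y] using this
  have hgx : g x = false := by
    by_contra hc
    rw [Bool.not_eq_false] at hc
    have hall : ∀ y, g (x ⊔ y) = true := fun y => by
      have := hg (le_sup_left : x ≤ x ⊔ y); rw [hc] at this; exact top_le_iff.1 this
    refine hnf ⟨h1.1, fun y hy => ?_⟩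
    have := hmin.2 y hy
    simpa [hall y] using this
  refine ⟨⟨hfx, ?_⟩, ⟨hgx, ?_⟩⟩
  · rcases isMinterm_or_exists_update hf x A h1.1 with h | h
    · exact absurd h hnf
    · exact h
  · rcases isMinterm_or_exists_update hg x A h1.2 with h | h
    · exact absurd h hng
    · exact h

/-- **Descent-split ⟹ pair-leak** (v5, lead c2): for the wire functions `ap` of a well-formed
program with exact `∧`-gates and monotone valid wires, the descent-split event of stub E at `(x, A)`
implies that some `∧`-gate `u ∧ v` of the program has BOTH children rejecting `x` and accepting
`x ⊔ (K_A − e)` for some edge `e` of `K_A` (`split_leaky` at the terminal gate of the descent; the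
children of gate `m` are valid wires by well-formedness). So the needle's event is a sub-event of a
path-free SECOND-ORDER planted-invisibility event; its first-order version is stub B. [folklore; this line, lead c2] -/
theorem pairLeak_of_descentSplit {n : ℕ} {gs : List (Gate (Edges n))}
    {ap : Edges n ⊕ ℕ → (Edges n → Bool) → Bool} (hwf : GateList.WF gs)
    (hand : ∀ (m : ℕ) (u v : Edges n ⊕ ℕ), gs[m]? = some (GateList.andGate u v) →
        ap (Sum.inr m) = fun x => ap u x && ap v x)
    (hmono : ∀ w, GateList.OutOK gs.length w → Monotone (ap w))
    {x : Edges n → Bool} {A : Finset (Fin n)} {out : Edges n ⊕ ℕ}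
    (h : ∃ (r m : ℕ) (u v : Edges n ⊕ ℕ) (w : ℕ → Edges n ⊕ ℕ),
        w 0 = out ∧ w r = Sum.inr m ∧ gs[m]? = some (GateList.andGate u v) ∧
        (∀ i, i < r → ∃ (m' : ℕ) (u' v' : Edges n ⊕ ℕ), w i = Sum.inr m' ∧
            (gs[m']? = some (GateList.andGate u' v') ∨ gs[m']? = some (GateList.orGate u' v')) ∧
            (w (i + 1) = u' ∨ w (i + 1) = v')) ∧
        (∀ i, i ≤ r → IsMinterm (fun y => ap (w i) (x ⊔ y)) (cliqueVec A)) ∧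
        ¬ IsMinterm (fun y => ap u (x ⊔ y)) (cliqueVec A) ∧
        ¬ IsMinterm (fun y => ap v (x ⊔ y)) (cliqueVec A)) :
    ∃ (m : ℕ) (u v : Edges n ⊕ ℕ), gs[m]? = some (GateList.andGate u v) ∧
      (ap u x = false ∧ ∃ e, cliqueVec A e = true ∧
        ap u (x ⊔ Function.update (cliqueVec A) e false) = true) ∧
      (ap v x = false ∧ ∃ e, cliqueVec A e = true ∧
        ap v (x ⊔ Function.update (cliqueVec A) e false) = true) := by
  obtain ⟨r, m, u, v, w, -, hr, hg, -, hmin, hnu, hnv⟩ := h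
  have hml : m < gs.length := by
    by_contra hc
    push Not at hc
    rw [List.getElem?_eq_none hc] at hg
    exact Option.some_ne_none _ hg.symm
  have hgOK : GateOK m (GateList.andGate u v) := hwf m _ hg
  have hu : OutOK gs.length u := fun n' hn' => (hgOK (0 : Fin 2) n' hn').trans hml
  have hv : OutOK gs.length v := fun n' hn' => (hgOK (1 : Fin 2) n' hn').trans hml
  have hm : IsMinterm (fun y => ap u (x ⊔ y) && ap v (x ⊔ y)) (cliqueVec A) := by
    have := hmin r le_rfl
    rw [hr, hand m u v hg] at this
    exact this
  exact ⟨m, u, v, hg, split_leaky (hmono u hu) (hmono v hv) x A hm hnu hnv⟩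

/-! ## Composition I (sorry-free): NoisyIndist from stubs B–E -/

/-- **NoisyIndist at given `(c, k, ε)` from the descent-split bound at `(c, k, ε)`** (kernel-checked
glue): if `k ≥ 5`, `0 < ε ≤ k⁻³` and the descent-split mass is eventually `≤ γ` for every `γ > 0`
(the shape of stub E's matrix), then every monotone `{∧₂,∨₂,0,1}`-circuit `D` of size `≤ n^c` has
advantage `≤ γ` between `S ∪ K_A` and `S`, eventually, for every `γ > 0`. Chain: `D` constant
(advantage `0`) or a `{∧₂,∨₂}`-program (`const_or_exists_monotone_circuit`); structural approximation
`f̄` (stub C); `adv(D) ≤ adv(f̄) + Pr_q[f̄ ≠ D]` (`dom` + Lemma 13 `err`, `≤ n^c·#(I∪J)·e^{-n^ε} → 0`);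
`adv(f̄) ≤ exact-minterm mass + minus-an-edge mass` (`adv_le_split_sum`); the first is a descent-split
mass (stub D) `≤ γ/2` (hypothesis), the second `≤ n^{-c₁}` (stub B). [folklore] -/
theorem noisyIndist_at (c k : ℕ) (ε : ℝ) (hk5 : 5 ≤ k) (hε0 : 0 < ε) (hεk : ε ≤ 1 / (k : ℝ) ^ 3)
    (hE : ∀ γ : ℝ, 0 < γ → ∀ᶠ n : ℕ in atTop,
          ∀ (gs : List (Gate (Edges n))) (out : Edges n ⊕ ℕ)
            (ap : Edges n ⊕ ℕ → (Edges n → Bool) → Bool),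
            GateList.WF gs → (∀ g ∈ gs, g.fn ∈ monotoneBasis) → gs.length ≤ n ^ c →
            GateList.OutOK gs.length out →
            (∀ i, ap (Sum.inl i) = fun x => x i) →
            (∀ (m : ℕ) (u v : Edges n ⊕ ℕ), gs[m]? = some (GateList.andGate u v) →
                ap (Sum.inr m) = fun x => ap u x && ap v x) →
            (∀ (m : ℕ) (u v : Edges n ⊕ ℕ), gs[m]? = some (GateList.orGate u v) →
                ap (Sum.inr m) =
                  starClosure (pMinus k ε n) (tThr ε n) (smallI n k ∪ medJ n k)
                    (fun x => ap u x || ap v x)) →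
            StarApproxInv (pMinus k ε n) (tThr ε n) (smallI n k) (medJ n k) gs ap →
              (∑ x : Edges n → Bool, gnpWeight n (pMinus k ε n) x * kSubsetProb n k (fun A =>
                  ∃ (r m : ℕ) (u v : Edges n ⊕ ℕ) (w : ℕ → Edges n ⊕ ℕ),
                    w 0 = out ∧ w r = Sum.inr m ∧ gs[m]? = some (GateList.andGate u v) ∧
                    (∀ i, i < r → ∃ (m' : ℕ) (u' v' : Edges n ⊕ ℕ), w i = Sum.inr m' ∧
                        (gs[m']? = some (GateList.andGate u' v') ∨
                          gs[m']? = some (GateList.orGate u' v')) ∧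
                        (w (i + 1) = u' ∨ w (i + 1) = v')) ∧
                    (∀ i, i ≤ r → IsMinterm (fun y => ap (w i) (x ⊔ y)) (cliqueVec A)) ∧
                    ¬ IsMinterm (fun y => ap u (x ⊔ y)) (cliqueVec A) ∧
                    ¬ IsMinterm (fun y => ap v (x ⊔ y)) (cliqueVec A))) ≤ γ) :
    ∀ γ : ℝ, 0 < γ →
      ∀ᶠ n : ℕ in atTop, ∀ D : Circuit (⊤ : SimpleGraph (Fin n)).edgeSet,
        D.IsOver monotoneBasis01 → D.size ≤ n ^ c →
          (∑ x : ((⊤ : SimpleGraph (Fin n)).edgeSet → Bool),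
              gnpWeight n (pMinus k ε n) x *
                kSubsetProb n k (fun A => D.eval (x ⊔ cliqueVec A) = true)) -
            gnpProb n (pMinus k ε n) (univ.filter fun x => D.eval x = true) ≤ γ := by
  obtain ⟨c₁, hc₁, hB⟩ := stub_cliqueMinusEdgeInvisible k hk5 ε hε0 hεk
  intro γ hγ
  -- eventually-facts
  have hEγ := hE (γ / 2) (by positivity)
  have hlarge := eventually_largeN hk5 hε0 hεk 1 1 one_pos
  have hc₁ev : ∀ᶠ n : ℕ in atTop, (n : ℝ) ^ (-c₁) ≤ γ / 4 :=
    ((tendsto_rpow_neg_atTop hc₁).comp tendsto_natCast_atTop_atTop).eventually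
      (eventually_le_nhds (by positivity))
  have hexp1 := eventually_poly_mul_exp_le (A := (2 : ℝ) ^ k.choose 2) (m := (c : ℝ) + k) (d := ε)
    (c' := ε / 2) hε0 (by linarith)
  have hexp2 : ∀ᶠ n : ℕ in atTop, Real.exp (-((n : ℝ) ^ (ε / 2))) ≤ γ / 2 := by
    have h1 : Tendsto (fun n : ℕ => Real.exp (-((n : ℝ) ^ (ε / 2)))) atTop (𝓝 0) := by
      have := ((tendsto_rpow_atTop (by positivity : (0 : ℝ) < ε / 2)).comp
        tendsto_natCast_atTop_atTop)
      exact Real.tendsto_exp_atBot.comp (tendsto_neg_atTop_atBot.comp this)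
    exact h1.eventually (eventually_le_nhds (by positivity))
  filter_upwards [hEγ, hB, hlarge, hc₁ev, hexp1, hexp2, eventually_ge_atTop 1]
    with n hEn hBn hLn hc₁n hexp1n hexp2n hn1
  intro D hD hDsize
  -- parameters at this `n`
  have hkn : k ≤ n := hLn.hkn
  have hnr : (0 : ℝ) < n := by exact_mod_cast (show 0 < n by omega)
  set q : ℝ := pMinus k ε n with hqdef
  set t : ℝ := tThr ε n with htdef
  set K := smallI n k ∪ medJ n k with hKdef
  have hq0 : 0 < q := Real.rpow_pos_of_pos hnr _
  have hq1 : q ≤ 1 := by have := hLn.hp; rw [← hqdef] at this; linarith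
  have ht0 : 0 < t := Real.exp_pos _
  have htq : t < 1 - q := by
    have h1 := hLn.hp; have h2 := hLn.ht
    rw [← hqdef] at h1; rw [← htdef] at h2
    linarith
  -- constant circuits have advantage `0`
  rcases const_or_exists_monotone_circuit D.gates D.output (wf_gates D) hD D.wf_output with
    ⟨b, hb⟩ | ⟨C', hC', hsize', hC'eval⟩
  · have hDb : ∀ x, D.eval x = b := fun x => by rw [circuit_eval]; exact hb x
    cases b
    · have h1 : ∀ x : Edges n → Bool,
          kSubsetProb n k (fun A => D.eval (x ⊔ cliqueVec A) = true) = 0 := by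
        intro x
        unfold kSubsetProb
        rw [filter_false_of_mem, card_empty, Nat.cast_zero, zero_div]
        intro A _; rw [hDb]; exact Bool.false_ne_true
      simp only [h1, mul_zero, sum_const_zero, zero_sub]
      have := gnpProb_nonneg hq0.le hq1 (univ.filter fun x : Edges n → Bool => D.eval x = true)
      linarith
    · have h1 : ∀ x : Edges n → Bool,
          kSubsetProb n k (fun A => D.eval (x ⊔ cliqueVec A) = true) = 1 := by
        intro x
        rw [kSubsetProb_congr (Q := fun _ => True) (fun A => by simp [hDb]), kSubsetProb_true hkn]
      have h2 : gnpProb n q (univ.filter fun x : Edges n → Bool => D.eval x = true) = 1 := by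
        rw [filter_true_of_mem (fun x _ => hDb x), gnpProb_univ]
      simp only [h1, mul_one, h2]
      rw [show (∑ x : Edges n → Bool, gnpWeight n q x) = gnpProb n q univ from rfl, gnpProb_univ]
      linarith
  -- the `{∧₂,∨₂}`-program and its structural closure
  have hDeval : ∀ x, D.eval x = wireOf x (vals C'.gates x) C'.output := fun x => by
    rw [← circuit_eval C' x, hC'eval x, circuit_eval D x]
  set gs := C'.gates with hgs
  set out := C'.output with hout
  have hwf : WF gs := wf_gates C'
  have houtOK : OutOK gs.length out := C'.wf_output
  have hL : gs.length ≤ n ^ c := by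
    have : C'.size ≤ D.size := hsize'
    exact le_trans this hDsize
  obtain ⟨ap, hinl, hand, hor, hap⟩ := stub_structuralApprox hq0.le hq1 ht0.le htq
    (fun e => indVec_singleton_mem_smallI (n := n) (k := k) hk5 e)
    (fun x hx y hy => sup_mem_smallI_union_medJ hx hy) gs hwf hC'
  have hfm : Monotone (ap out) := hap.mono _ houtOK
  -- `D ≤ f̄` pointwise
  have hdom : ∀ x, D.eval x = true → ap out x = true := fun x hx => by
    rw [hDeval] at hx
    exact hap.dom _ houtOK x hx
  -- Lemma 13: `Pr_q[f̄ ≠ D] ≤ L·#K·t ≤ γ/4`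
  have hKcard : (#K : ℝ) ≤ (n : ℝ) ^ (k : ℝ) * (2 : ℝ) ^ k.choose 2 := by
    have h1 := card_smallI_union_medJ_le (n := n) (k := k) hkn
    have h2 : (n.choose k : ℝ) ≤ (n : ℝ) ^ (k : ℝ) := by
      rw [Real.rpow_natCast]; exact_mod_cast Nat.choose_le_pow n k
    calc (#K : ℝ) ≤ (n.choose k : ℝ) * (2 : ℝ) ^ k.choose 2 := by exact_mod_cast h1
      _ ≤ (n : ℝ) ^ (k : ℝ) * (2 : ℝ) ^ k.choose 2 :=
          mul_le_mul_of_nonneg_right h2 (by positivity)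
  have herr : gnpProb n q (univ.filter fun x => ap out x ≠ D.eval x) ≤ γ / 4 := by
    have h1 : gnpProb n q (univ.filter fun x => ap out x ≠ D.eval x) ≤ gs.length * (#K * t) := by
      rw [gnpProb_filter_eq_prob]
      refine le_trans (prob_mono hq0.le hq1 fun x hx => ?_) hap.err
      by_contra hgood
      have h := hap.agree hgood _ houtOK
      exact hx (by rw [hDeval x, h])
    have h2 : (gs.length : ℝ) * (#K * t) ≤
        (2 : ℝ) ^ k.choose 2 * (n : ℝ) ^ ((c : ℝ) + k) * Real.exp (-((n : ℝ) ^ ε)) := by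
      have hLr : (gs.length : ℝ) ≤ (n : ℝ) ^ (c : ℝ) := by
        rw [Real.rpow_natCast]; exact_mod_cast hL
      have ht' : t = Real.exp (-((n : ℝ) ^ ε)) := rfl
      calc (gs.length : ℝ) * (#K * t) ≤ (n : ℝ) ^ (c : ℝ) * ((n : ℝ) ^ (k : ℝ) * (2 : ℝ) ^ k.choose 2 * t) := by
            refine mul_le_mul hLr (mul_le_mul_of_nonneg_right hKcard ht0.le) (by positivity)
              (by positivity)
        _ = (2 : ℝ) ^ k.choose 2 * ((n : ℝ) ^ (c : ℝ) * (n : ℝ) ^ (k : ℝ)) * t := by ring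
        _ = (2 : ℝ) ^ k.choose 2 * (n : ℝ) ^ ((c : ℝ) + k) * Real.exp (-((n : ℝ) ^ ε)) := by
            rw [← Real.rpow_add hnr, ht']
    have h3 : (1 : ℝ) / 2 * Real.exp (-((n : ℝ) ^ (ε / 2))) ≤ γ / 4 := by linarith
    linarith
  -- `adv(D) ≤ adv(f̄) + Pr[f̄ ≠ D]`
  have hadv1 : (∑ x : Edges n → Bool, gnpWeight n q x *
        kSubsetProb n k (fun A => D.eval (x ⊔ cliqueVec A) = true)) ≤
      ∑ x : Edges n → Bool, gnpWeight n q x * kSubsetProb n k (fun A => ap out (x ⊔ cliqueVec A) = true) := by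
    refine sum_le_sum fun x _ => mul_le_mul_of_nonneg_left ?_ (gnpWeight_nonneg hq0.le hq1 x)
    exact kSubsetProb_mono fun A hA => hdom _ hA
  have hadv2 : gnpProb n q (univ.filter fun x => ap out x = true) ≤
      gnpProb n q (univ.filter fun x => D.eval x = true) + γ / 4 :=
    (gnpProb_true_le_add_ne hq0.le hq1 (ap out) D.eval).trans (by linarith)
  -- `adv(f̄) ≤ exact-minterm mass + minus-an-edge mass`
  have hsplit := adv_le_split_sum (k := k) (q := q) hq0.le hq1 hfm
  -- stub B: the minus-an-edge mass
  have hBfb := hBn (ap out) hfm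
  -- stubs D + E: the exact-minterm mass is a descent-split mass
  have hDE : (∑ x : Edges n → Bool, gnpWeight n q x *
        kSubsetProb n k (fun A => IsMinterm (fun y => ap out (x ⊔ y)) (cliqueVec A))) ≤ γ / 2 := by
    refine le_trans (sum_le_sum fun x _ => mul_le_mul_of_nonneg_left
      (kSubsetProb_mono_card fun A hAk hA => ?_) (gnpWeight_nonneg hq0.le hq1 x))
      (hEn gs out ap hwf hC' hL houtOK hinl hand hor hap)
    exact stub_exactCliqueDescent (by omega) gs ap hwf hC' hinl hand hor (fun w hw => hap.mono w hw)
      x A hAk out houtOK hA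
  have hc₁n' : (n : ℝ) ^ (-c₁) ≤ γ / 4 := hc₁n
  linarith [hsplit, hBfb, hDE, hadv1, hadv2, herr]

/-- **NoisyIndist (∃ form) from stubs B–E**: for every `c` there are `k ≥ 5` and `ε > 0` such
that size-`n^c` monotone01 circuits have vanishing advantage between `S ∪ K_A` and `S`. [folklore] -/
theorem NoisyIndist_of :
    ∀ c : ℕ, ∃ k : ℕ, 5 ≤ k ∧ ∃ ε : ℝ, 0 < ε ∧ ∀ γ : ℝ, 0 < γ →
      ∀ᶠ n : ℕ in atTop, ∀ D : Circuit (⊤ : SimpleGraph (Fin n)).edgeSet,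
        D.IsOver monotoneBasis01 → D.size ≤ n ^ c →
          (∑ x : ((⊤ : SimpleGraph (Fin n)).edgeSet → Bool),
              gnpWeight n (pMinus k ε n) x *
                kSubsetProb n k (fun A => D.eval (x ⊔ cliqueVec A) = true)) -
            gnpProb n (pMinus k ε n) (univ.filter fun x => D.eval x = true) ≤ γ := by
  intro c
  obtain ⟨k₀, hk₀⟩ := stub_descentSplit c
  set k : ℕ := max k₀ 5 with hkdef
  have hk5 : 5 ≤ k := le_max_right _ _
  have hkk₀ : k₀ ≤ k := le_max_left _ _
  obtain ⟨ε₀, hε₀, hE⟩ := hk₀ k hkk₀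
  have hk3 : (0 : ℝ) < 1 / (k : ℝ) ^ 3 := by positivity
  set ε : ℝ := min ε₀ (1 / (k : ℝ) ^ 3) with hεdef
  have hε0 : 0 < ε := lt_min hε₀ hk3
  have hεε₀ : ε ≤ ε₀ := min_le_left _ _
  have hεk : ε ≤ 1 / (k : ℝ) ^ 3 := min_le_right _ _
  exact ⟨k, hk5, ε, hε0, noisyIndist_at c k ε hk5 hε0 hεk (hE ε hε0 hεε₀)⟩

/-- **NoisyIndist (strong `∀ k ≥ k₀, ∀ ε ≤ ε₀` form) from stubs B–E.** [folklore] -/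
theorem NoisyIndistStrong_of :
    ∀ c : ℕ, ∃ k₀ : ℕ, ∀ k : ℕ, k₀ ≤ k → ∃ ε₀ : ℝ, 0 < ε₀ ∧ ∀ ε : ℝ, 0 < ε → ε ≤ ε₀ →
      ∀ γ : ℝ, 0 < γ →
      ∀ᶠ n : ℕ in atTop, ∀ D : Circuit (⊤ : SimpleGraph (Fin n)).edgeSet,
        D.IsOver monotoneBasis01 → D.size ≤ n ^ c →
          (∑ x : ((⊤ : SimpleGraph (Fin n)).edgeSet → Bool),
              gnpWeight n (pMinus k ε n) x *
                kSubsetProb n k (fun A => D.eval (x ⊔ cliqueVec A) = true)) -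
            gnpProb n (pMinus k ε n) (univ.filter fun x => D.eval x = true) ≤ γ := by
  intro c
  obtain ⟨k₀, hk₀⟩ := stub_descentSplit c
  refine ⟨max k₀ 5, fun k hk => ?_⟩
  have hk5 : 5 ≤ k := le_trans (le_max_right _ _) hk
  have hkk₀ : k₀ ≤ k := le_trans (le_max_left _ _) hk
  obtain ⟨ε₀, hε₀, hE⟩ := hk₀ k hkk₀
  have hk3 : (0 : ℝ) < 1 / (k : ℝ) ^ 3 := by positivity
  refine ⟨min ε₀ (1 / (k : ℝ) ^ 3), lt_min hε₀ hk3, fun ε hε0 hεle => ?_⟩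
  exact noisyIndist_at c k ε hk5 hε0 (hεle.trans (min_le_right _ _))
    (hE ε hε0 (hεle.trans (min_le_left _ _)))

/-! ## The sparse-dose dial (cycle 2): a WEAKER needle on the critical path

Notation: `p = p_c n k = n^{-2/(k-1)}`, `q = pMinus k ε n` (background), `ρ = n^{-σ}` (a fresh DOSE
`R ∼ G(n,ρ)`, `≈ n^{2-σ}/2` random edges), `p ⊕ ρ = p + ρ − pρ`. For a circuit `D` the *relative
sparse-dose advantage* is `E D(S ∪ K_A) − E_{S,R} D(S ∪ R)` ("planted clique versus dose, on top of the
background"). FACTS: (i) it is `≤ adv_q(D)` for monotone `D` (`rsdAdv_le_adv`), so NoisyIndist ⟹ RSD at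
every `σ`; (ii) Rossman's Theorem 1 applied to the restrictions `D^S` PROVES RSD at the dense dose
`ρ = p^{1+k⁻³}` (`σ_T1 = 2(1+k⁻³)/(k−1)`): a planted clique is worth at most one admissible dose
(LANDED: `Literature.Computability.Complexity.rsd_at_admissible_dose`, p93808); (iii) in the two-round transfer the dose
composes with the first round to density `p ⊕ ρ`, and `TV(G(n,p⊕ρ), G(n,p)) → 0` iff `Nρ ≪ √(Np)` iff
`σ > 1 + 1/(k−1)` (`stub_gnpTVSprinkle`, χ² of product measures), so RSD at ANY `σ > 1 + 1/(k−1)`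
already gives the crux (`stub_doseTransfer`). The crux is therefore EXACTLY the problem of turning the
sprinkle exponent of the RELATIVE Theorem 1 from `σ_T1 ≈ 2/k` (proved) up past `1 + 1/(k−1)` (a dose of
fewer than `√(Np) = n^{1−1/(k−1)}` edges): needle `stub_relativeSparseDose`, formally weaker than
`stub_descentSplit` (`relativeSparseDose_of_descentSplit`, sorry-free modulo E). DIAL MILESTONE (cycle 3,
landed): `Literature.Computability.Complexity.thm1_sparse_finite` (p94633) / `thm1_sparse` (p99772) —
Theorem 1 with the class parameter decoupled from `k` and Lemma 15 replaced by an I-count — gives the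
first `k`-INDEPENDENT point: noise `n^{-ρ}` for every `ρ < 1/(2(c+1))`, size `n^c`, all `k ≥ 4(c+1)`;
applied to restrictions `D^S` it is RSD(σ) for `σ < 1/(2(c+2))` POINTWISE in the background `S` — LANDED as
`Literature.Computability.Complexity.rsd_at_sparse_dose` (p119747, exactly the matrix of
`stub_relativeSparseDose` at a small dose exponent, every background law). Pointwise
statements are false beyond `σ ≈ 2/(c−1)` (`∃K_c` on `S = ∅`), so the target range needs typical `S`
(crux idea card Ideas/relative-sparse-dose-dial.md). -/

/-- **Stub F — dose transfer (LANDED p93385, `Summit.PneNP.PneNP.Theorems.SingleThreshold.stub_doseTransfer`).** For `c, k ≥ 5, ε > 0, σ > 1 + 1/(k−1)`: if every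
monotone01 circuit `D` of size `≤ n^{c+1}` has relative sparse-dose advantage
`E D(S ∪ K_A) − E_{S,R} D(S ∪ R) ≤ γ` eventually, for every `γ > 0` (`S ∼ G(n, pMinus k ε n)`,
`R ∼ G(n, n^{-σ})`, `A` a uniform `k`-set), and `TV(G(n, p_c ⊕ n^{-σ}), G(n, p_c)) → 0`, then
`∃ δ > 0 ∀ᶠ n ∀ C` monotone, `err_p(C) ≤ δ → n^c < |C|`. Proof: as `stub_twoRoundTransfer`
(landed: `adv_lower_bound` gives `adv_p(C) ≥ κ₀/2`; `adv_p(C)` is the `w_{p₁}`-average of the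
`q`-advantages of the restrictions `C^{H'}`, `p₁ ⊕ q = p`), but now split
`adv_q(D) = [E D(S∪K_A) − E D(S∪R)] + [E D(S∪R) − E D(S)]`: the first bracket is `≤ γ` by hypothesis,
and the `H'`-average of the second is `Φ_C(p ⊕ ρ) − Φ_C(p) ≤ Σ_z |w_{p⊕ρ}(z) − w_p(z)| → 0`
(union law `sum_sum_gnpWeight_mul_sup` twice: `(p₁ ⊕ q) ⊕ ρ = p ⊕ ρ`). [cite: Rossman2010, §7 and
App. B (pp. 10, 13–14); this line] -/
theorem stub_doseTransfer :
    ∀ (c k : ℕ) (ε σ : ℝ), 5 ≤ k → 0 < ε → 1 + 1 / ((k : ℝ) - 1) < σ →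
      (∀ γ : ℝ, 0 < γ →
      ∀ᶠ n : ℕ in atTop, ∀ D : Circuit (Edges n),
        D.IsOver monotoneBasis01 → D.size ≤ n ^ (c + 1) →
          (∑ x : Edges n → Bool, gnpWeight n (pMinus k ε n) x *
                kSubsetProb n k (fun A => D.eval (x ⊔ cliqueVec A) = true)) -
            (∑ x : Edges n → Bool, ∑ y : Edges n → Bool,
                gnpWeight n (pMinus k ε n) x * gnpWeight n ((n : ℝ) ^ (-σ)) y *
                  (if D.eval (x ⊔ y) = true then (1 : ℝ) else 0)) ≤ γ) →
      Tendsto (fun n : ℕ => ∑ z : Edges n → Bool,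
        |gnpWeight n (pc n k + (n : ℝ) ^ (-σ) - pc n k * (n : ℝ) ^ (-σ)) z - gnpWeight n (pc n k) z|)
        atTop (𝓝 0) →
      ∃ δ : ℝ, 0 < δ ∧ ∀ᶠ n : ℕ in Filter.atTop,
        ∀ C : Literature.Computability.Complexity.Circuit ((⊤ : SimpleGraph (Fin n)).edgeSet),
          C.IsOver Literature.Computability.Complexity.monotoneBasis →
            (Finset.univ.filter (fun x : ((⊤ : SimpleGraph (Fin n)).edgeSet) → Bool =>
                C.eval x ≠ decide (¬ (SimpleGraph.fromEdgeSet {e : Sym2 (Fin n) |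
                  ∃ h : e ∈ (⊤ : SimpleGraph (Fin n)).edgeSet, x ⟨e, h⟩ = true}).CliqueFree k))).sum
              (fun x => ((n : ℝ) ^ (-(2 : ℝ) / ((k : ℝ) - 1))) ^ (Finset.univ.filter (fun e => x e = true)).card *
                (1 - (n : ℝ) ^ (-(2 : ℝ) / ((k : ℝ) - 1))) ^
                  (n.choose 2 - (Finset.univ.filter (fun e => x e = true)).card)) ≤ δ →
            n ^ c < C.size :=
  _root_.Summit.PneNP.PneNP.Theorems.SingleThreshold.stub_doseTransfer

/-- **Stub G — a CLT-invisible sprinkle (LANDED p93648, `Summit.PneNP.PneNP.Theorems.SingleThreshold.stub_gnpTVSprinkle`).** For `k ≥ 3` and `σ > 1 + 1/(k−1)`: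
`TV(G(n, p_c ⊕ n^{-σ}), G(n, p_c)) = Σ_z |w_{p⊕ρ}(z) − w_p(z)| → 0`. Why true: for product Bernoulli
measures `χ²(μ_{p'} ‖ μ_p) = (1 + (p'−p)²/(p(1−p)))^N − 1` (coordinatewise, `ProductWeights.sum_prod_weight`),
with `p' − p = ρ(1 − p)` this is `(1 + ρ²(1−p)/p)^N − 1 ≤ exp(Nρ²/p) − 1 ≤ 2Nρ²/p` once `Nρ²/p ≤ 1`,
and `Nρ²/p ≤ n^{2 − 2σ + 2/(k−1)} → 0` iff `σ > 1 + 1/(k−1)`; finally `(Σ|w_{p'} − w_p|)² ≤ χ²·Σ w_p = χ²`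
(Cauchy–Schwarz). [folklore; cf. Janson–Łuczak–Ruciński, Random Graphs, §1.6 (asymptotic equivalence of G(n,p), G(n,p'))] -/
theorem stub_gnpTVSprinkle :
    ∀ k : ℕ, 3 ≤ k → ∀ σ : ℝ, 1 + 1 / ((k : ℝ) - 1) < σ →
      Tendsto (fun n : ℕ => ∑ z : Edges n → Bool,
        |gnpWeight n (pc n k + (n : ℝ) ^ (-σ) - pc n k * (n : ℝ) ^ (-σ)) z - gnpWeight n (pc n k) z|)
        atTop (𝓝 0) :=
  _root_.Summit.PneNP.PneNP.Theorems.SingleThreshold.stub_gnpTVSprinkle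

/-- **Stub E′ — RelativeSparseDose (OPEN — the NEEDLE on the critical path; the weak end of the dial).**
For every exponent `c` there is `k₀` such that for all `k ≥ k₀` and all small `ε` there is a dose
exponent `σ > 1 + 1/(k−1)` with: for every `γ > 0`, eventually in `n`, every monotone `{∧₂,∨₂,0,1}`-circuit
`D` of size `≤ n^c` satisfies `E D(S ∪ K_A) − E_{S,R} D(S ∪ R) ≤ γ`, `S ∼ G(n, pMinus k ε n)`,
`R ∼ G(n, n^{-σ})` independent, `A` a uniform `k`-set: ON THE JUST-SUBCRITICAL BACKGROUND, A PLANTED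
`k`-CLIQUE TRIGGERS A SMALL MONOTONE CIRCUIT NO MORE THAN `n^{2−σ} < √(Np)` FRESH RANDOM EDGES DO. Why
plausibly true: the same statement with the dense dose `σ_T1 = 2(1+k⁻³)/(k−1)` is Rossman's Theorem 1
applied to the restrictions `D^S` (proved in tree, `thm1_finite`); it is implied by NoisyIndist /
`stub_descentSplit` (`relativeSparseDose_of_descentSplit`); every counting statistic prefers the dose
(it has `≫ k²` edges), and the only bounded pattern that `K_A` creates and the dose does not is `K_k`
itself (every proper subgraph of `K_k` is abundant in `S`; near-complete patterns get `O_k(1)` new copies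
against fluctuations `n^{Ω(1)}`). Why hard: Rossman's closure w.r.t. the dose reaches only `σ < ~4/k`
(the `J`-bottleneck `supp − σ·edges > 0`); beyond it the dose-sunflower counts `n^{σ s}` are trivial,
and the dose-closure window in which a live threshold is neither erased nor dead has background
probability `n^{(1−σ/2) − λ₁}` per wire — the `√m` wall again; the target window
`σ ∈ (1 + 1/(k−1), 1 + (1+ε)/(k−1)]` is where the dose is visible at level `q` but invisible at level `p`.
No catalogued barrier applies (monotone, average-case). [cite: Rossman2010, §9 (p. 11); this crux's
Lines/two-round-exposure.md; lead NOTES (dial)] -/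
theorem stub_relativeSparseDose :
    ∀ c : ℕ, ∃ k₀ : ℕ, ∀ k : ℕ, k₀ ≤ k → ∃ ε₀ : ℝ, 0 < ε₀ ∧ ∀ ε : ℝ, 0 < ε → ε ≤ ε₀ →
      ∃ σ : ℝ, 1 + 1 / ((k : ℝ) - 1) < σ ∧ ∀ γ : ℝ, 0 < γ →
      ∀ᶠ n : ℕ in atTop, ∀ D : Circuit (Edges n),
        D.IsOver monotoneBasis01 → D.size ≤ n ^ c →
          (∑ x : Edges n → Bool, gnpWeight n (pMinus k ε n) x *
                kSubsetProb n k (fun A => D.eval (x ⊔ cliqueVec A) = true)) -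
            (∑ x : Edges n → Bool, ∑ y : Edges n → Bool,
                gnpWeight n (pMinus k ε n) x * gnpWeight n ((n : ℝ) ^ (-σ)) y *
                  (if D.eval (x ⊔ y) = true then (1 : ℝ) else 0)) ≤ γ := by
  sorry

/-- Adding an independent dose can only help a monotone test: `E D(S) ≤ E_{S,R} D(S ∪ R)`
(coupling; weights of the dose are a probability vector for `0 ≤ ρ ≤ 1`). [folklore] -/
theorem gnpProb_le_sum_sum_dose {n : ℕ} {q ρ : ℝ} (hq0 : 0 ≤ q) (hq1 : q ≤ 1) (hρ0 : 0 ≤ ρ)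
    (hρ1 : ρ ≤ 1) {f : (Edges n → Bool) → Bool} (hf : Monotone f) :
    gnpProb n q (univ.filter fun x => f x = true) ≤
      ∑ x : Edges n → Bool, ∑ y : Edges n → Bool,
        gnpWeight n q x * gnpWeight n ρ y * (if f (x ⊔ y) = true then (1 : ℝ) else 0) := by
  rw [gnpProb_eq_sum_ite]
  refine sum_le_sum fun x _ => ?_
  have hw := gnpWeight_nonneg hq0 hq1 x
  have h1 : (if f x = true then (1 : ℝ) else 0) =
      ∑ y : Edges n → Bool, gnpWeight n ρ y * (if f x = true then (1 : ℝ) else 0) := by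
    rw [← sum_mul, show (∑ y : Edges n → Bool, gnpWeight n ρ y) = gnpProb n ρ univ from rfl,
      gnpProb_univ, one_mul]
  rw [h1, mul_sum]
  refine sum_le_sum fun y _ => ?_
  rw [mul_assoc]
  refine mul_le_mul_of_nonneg_left (mul_le_mul_of_nonneg_left ?_ (gnpWeight_nonneg hρ0 hρ1 y)) hw
  by_cases hfx : f x = true
  · have : f (x ⊔ y) = true := by
      have := hf (le_sup_left : x ≤ x ⊔ y); rw [hfx] at this; exact top_le_iff.1 this
    rw [if_pos hfx, if_pos this]
  · rw [if_neg hfx]; split_ifs <;> norm_num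

/-- **NoisyIndist ⟹ RSD at every dose**: the relative sparse-dose advantage is at most the plain
advantage. [folklore] -/
theorem rsdAdv_le_adv {n k : ℕ} {q ρ : ℝ} (hq0 : 0 ≤ q) (hq1 : q ≤ 1) (hρ0 : 0 ≤ ρ) (hρ1 : ρ ≤ 1)
    (D : Circuit (Edges n)) (hD : D.IsOver monotoneBasis01) :
    (∑ x : Edges n → Bool, gnpWeight n q x *
          kSubsetProb n k (fun A => D.eval (x ⊔ cliqueVec A) = true)) -
      (∑ x : Edges n → Bool, ∑ y : Edges n → Bool,
          gnpWeight n q x * gnpWeight n ρ y * (if D.eval (x ⊔ y) = true then (1 : ℝ) else 0)) ≤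
    (∑ x : Edges n → Bool, gnpWeight n q x *
          kSubsetProb n k (fun A => D.eval (x ⊔ cliqueVec A) = true)) -
      gnpProb n q (univ.filter fun x => D.eval x = true) := by
  have := gnpProb_le_sum_sum_dose (n := n) hq0 hq1 hρ0 hρ1 (D.monotone_eval_of_isOver_monotoneBasis01 hD)
  linarith

/-- **The strong needle implies the weak one**: `stub_descentSplit` ⟹ NoisyIndist (∀ form) ⟹
RelativeSparseDose (with the dose exponent `σ = 2 + 1/(k−1)`, say). Sorry-free modulo stub E. [folklore] -/
theorem relativeSparseDose_of_descentSplit :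
    ∀ c : ℕ, ∃ k₀ : ℕ, ∀ k : ℕ, k₀ ≤ k → ∃ ε₀ : ℝ, 0 < ε₀ ∧ ∀ ε : ℝ, 0 < ε → ε ≤ ε₀ →
      ∃ σ : ℝ, 1 + 1 / ((k : ℝ) - 1) < σ ∧ ∀ γ : ℝ, 0 < γ →
      ∀ᶠ n : ℕ in atTop, ∀ D : Circuit (Edges n),
        D.IsOver monotoneBasis01 → D.size ≤ n ^ c →
          (∑ x : Edges n → Bool, gnpWeight n (pMinus k ε n) x *
                kSubsetProb n k (fun A => D.eval (x ⊔ cliqueVec A) = true)) -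
            (∑ x : Edges n → Bool, ∑ y : Edges n → Bool,
                gnpWeight n (pMinus k ε n) x * gnpWeight n ((n : ℝ) ^ (-σ)) y *
                  (if D.eval (x ⊔ y) = true then (1 : ℝ) else 0)) ≤ γ := by
  intro c
  obtain ⟨k₀, hk₀⟩ := NoisyIndistStrong_of c
  refine ⟨max k₀ 5, fun k hk => ?_⟩
  have hk5 : 5 ≤ k := le_trans (le_max_right _ _) hk
  obtain ⟨ε₀, hε₀, hN⟩ := hk₀ k (le_trans (le_max_left _ _) hk)
  refine ⟨ε₀, hε₀, fun ε hε0 hεle => ⟨2 + 1 / ((k : ℝ) - 1), by linarith, fun γ hγ => ?_⟩⟩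
  have hk1 : (0 : ℝ) < (k : ℝ) - 1 := by
    have : (5 : ℝ) ≤ k := by exact_mod_cast hk5
    linarith
  have hσ0 : (0 : ℝ) < 2 + 1 / ((k : ℝ) - 1) := by positivity
  filter_upwards [hN ε hε0 hεle γ hγ, eventually_ge_atTop 1] with n hn hn1
  intro D hD hsize
  have hnr : (1 : ℝ) ≤ n := by exact_mod_cast hn1
  have hq0 : 0 ≤ pMinus k ε n := Real.rpow_nonneg (by linarith) _
  have hq1 : pMinus k ε n ≤ 1 :=
    Real.rpow_le_one_of_one_le_of_nonpos hnr
      (div_nonpos_of_nonpos_of_nonneg (by nlinarith) hk1.le)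
  have hρ0 : 0 ≤ (n : ℝ) ^ (-(2 + 1 / ((k : ℝ) - 1))) := Real.rpow_nonneg (by linarith) _
  have hρ1 : (n : ℝ) ^ (-(2 + 1 / ((k : ℝ) - 1))) ≤ 1 :=
    Real.rpow_le_one_of_one_le_of_nonpos hnr (by linarith)
  exact (rsdAdv_le_adv hq0 hq1 hρ0 hρ1 D hD).trans (hn D hD hsize)

/-! ## v4 (lead c1, cycle 1): the background dial, dial calibration, Lemma 13 under planting — stubs H–L -/

/-- **Stub H — NoisyIndist is monotone in the background density (NEW, provable; the transfer behind
`SingleThreshold_of_nis`).** At one `n`: if every monotone01 circuit of size `≤ s + 1` has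
noisy-planted advantage `≤ γ` over the background `G(n, q_b)`, then every monotone01 circuit of size
`≤ s` has advantage `≤ γ` over the denser background `G(n, q_a ⊕ q_b)`, `q_a ⊕ q_b = q_a + q_b − q_a q_b`
(`0 ≤ q_a ≤ 1`; nothing is assumed about `q_b`, the hypothesis is used as given).
Why true: `G(n, q_a ⊕ q_b) = S_a ∪ S_b` with independent rounds (union law `sum_sum_gnpWeight_mul_sup`,
applied to `F = Pr_A[D(· ⊔ K_A)]` and to `F = [D(·)]`, using `(y ⊔ z) ⊔ K_A = y ⊔ (z ⊔ K_A)`); for each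
first round `y` the restriction `D^y : z ↦ D(y ⊔ z)` is a monotone01 circuit of size `≤ s + 1`
(`Circuit.exists_restrict_sup`), so the hypothesis bounds its `q_b`-advantage by `γ`; average over `y`
with the probability weights `gnpWeight n q_a` (`gnpWeight_nonneg`, `sum_gnpWeight`). [folklore; this line] -/
theorem stub_backgroundMonotone {n k s : ℕ} {qa qb γ : ℝ} (hqa0 : 0 ≤ qa) (hqa1 : qa ≤ 1)
    (h : ∀ D : Circuit (Edges n), D.IsOver monotoneBasis01 → D.size ≤ s + 1 →
      (∑ x : Edges n → Bool, gnpWeight n qb x *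
          kSubsetProb n k (fun A => D.eval (x ⊔ cliqueVec A) = true)) -
        gnpProb n qb (univ.filter fun x => D.eval x = true) ≤ γ)
    (D : Circuit (Edges n)) (hD : D.IsOver monotoneBasis01) (hsize : D.size ≤ s) :
    (∑ x : Edges n → Bool, gnpWeight n (qa + qb - qa * qb) x *
        kSubsetProb n k (fun A => D.eval (x ⊔ cliqueVec A) = true)) -
      gnpProb n (qa + qb - qa * qb) (univ.filter fun x => D.eval x = true) ≤ γ :=
  _root_.Summit.PneNP.PneNP.Theorems.SingleThreshold.stub_backgroundMonotone hqa0 hqa1 h D hD hsize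

/-- **Stub I — NoisyIndistSparse (NEW NEEDLE, alternative critical path: NoisyIndist at a FIXED,
`k`-independent background density).** For every exponent `c` there are `β > 0` and `k₀` such that for
all `k ≥ k₀`: size-`n^c` monotone01 circuits cannot tell `S ∪ K_A` from `S` for `S ∼ G(n, n^{-β})`,
`A` a uniform `k`-set — `E_S Pr_A[D(S ∪ K_A)] − Pr_S[D(S)] ≤ γ` eventually, every `γ > 0`. By stub H it
implies NoisyIndist at every background `pMinus k ε n ≥ n^{-β}` (i.e. `2(1+ε)/(k−1) ≤ β`), hence the
crux (`SingleThreshold_of_nis`: `ε = 1`, `k ≥ 1 + 4/β`, stub A at `c`, this stub at `c + 2`). Why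
plausibly true, and the expected range: a size-`n^c` monotone circuit detects (a.a.s., Rossman Thm 3)
cliques of size up to `≈ 4c` and no larger structure; `G(n, n^{-β})` contains every pattern on fewer
than `2/β + 1` vertices, so for `β < ~1/(2c)` everything such a circuit can see is already present in
the background and the planted clique (however large `k`) adds nothing visible — whereas for
`β > ~1/(2c)` the statement is FALSE (size-`n^c` detectors of `K_{4c}` reject the background and accept
`S ∪ K_A`). The regime is far from criticality (`k ≫ 2/β`: `K_k` minus an edge is NOT in the background,
so the exact-minterm/minus-an-edge decomposition of the critical regime is replaced by arbitrary relative
minterms `Q ⊆ K_A`): single-edge relative minterms are harmless for EVERY monotone function (total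
influence `≤ n^{1+β/2}` against `n²/k²` positions), closure-added patterns and splits meeting the clique
in `≥ 2c + 2` vertices cost `n^{-(c+1)}` per wire (summable over `n^c` wires), and the whole difficulty
is relative minterms meeting the planted clique in `2 ≤ j ≤ 2c+1` vertices (per-wire cost `n^{-j}`, not
summable) — Rossman's §9 problem at a `k`-independent density. [cite: Rossman2010, §9 (p. 11); this line, lead c1] -/
theorem stub_noisyIndistSparse :
    ∀ c : ℕ, ∃ β : ℝ, 0 < β ∧ ∃ k₀ : ℕ, ∀ k : ℕ, k₀ ≤ k → ∀ γ : ℝ, 0 < γ →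
      ∀ᶠ n : ℕ in atTop, ∀ D : Circuit (Edges n), D.IsOver monotoneBasis01 → D.size ≤ n ^ c →
        (∑ x : Edges n → Bool, gnpWeight n ((n : ℝ) ^ (-β)) x *
            kSubsetProb n k (fun A => D.eval (x ⊔ cliqueVec A) = true)) -
          gnpProb n ((n : ℝ) ^ (-β)) (univ.filter fun x => D.eval x = true) ≤ γ := by
  sorry

/-- **Stub J — the dose is invisible relative to the background beyond the window (NEW, provable; dial
calibration).** For `k ≥ 3`, `ε ≥ 0` and `σ > 1 + (1+ε)/(k−1)`:
`TV(G(n, q ⊕ n^{-σ}), G(n, q)) = Σ_z |w_{q⊕ρ}(z) − w_q(z)| → 0`, `q = pMinus k ε n`, `ρ = n^{-σ}`.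
Why true: verbatim the χ²-computation of stub G (`stub_gnpTVSprinkle`, the case `ε = 0`):
`(Σ|w_{q'} − w_q|)² ≤ χ²(μ_{q'}‖μ_q) = (1 + ρ²(1−q)/q)^N − 1 ≤ 2Nρ²/q` once `Nρ²/q ≤ 1`
(`tv_sq_le_chiSq`, `chiSq_base_sprinkle`, `one_add_pow_sub_one_le_two_mul` of
Theorems/OneSliceSingleThresholdGnpTVSprinkle.lean), and `Nρ²/q ≤ n^{2 − 2σ + 2(1+ε)/(k−1)} → 0` iff
`σ > 1 + (1+ε)/(k−1)`. Used in `adv_le_rsd_add_tv`/`noisyIndist_of_rsd_beyond_window`: beyond the window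
the dose dial is FLAT (RSD_σ = NoisyIndist up to `o(1)`), so needle E′ is weaker than NoisyIndist only for
`σ` inside the window `(1 + 1/(k−1), 1 + (1+ε)/(k−1)]`. [folklore; cf. Janson–Łuczak–Ruciński, Random Graphs, §1.6] -/
theorem stub_doseInvisibleBeyondWindow :
    ∀ k : ℕ, 3 ≤ k → ∀ ε : ℝ, 0 ≤ ε → ∀ σ : ℝ, 1 + (1 + ε) / ((k : ℝ) - 1) < σ →
      Tendsto (fun n : ℕ => ∑ z : Edges n → Bool,
        |gnpWeight n (pMinus k ε n + (n : ℝ) ^ (-σ) - pMinus k ε n * (n : ℝ) ^ (-σ)) z -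
          gnpWeight n (pMinus k ε n) z|) atTop (𝓝 0) :=
  _root_.Summit.PneNP.PneNP.Theorems.SingleThreshold.stub_doseInvisibleBeyondWindow

/-- **Stub K — a planted `k`-clique is invisible in the supercritical dose (LANDED p140515,
`Summit.PneNP.PneNP.Theorems.SingleThreshold.stub_doseTrivialBelowCritical`; dial calibration).** For `k ≥ 3` and `0 < σ < 2/(k−1)` there is `c₂ > 0` such that eventually in `n`, for
EVERY test `f` (no monotonicity, no size bound):
`|E_{R,A} f(R ∪ K_A) − E_R f(R)| ≤ n^{-c₂}`, `R ∼ G(n, n^{-σ})`, `A` a uniform `k`-set. Why true: second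
moment of the planted likelihood ratio as in stub B (`sq_sum_adv_le`, `sum_gnpWeight_mul_lr_mul_lr` of
Literature/GnpPlantedLikelihoodRatio.lean; `card_filter_card_inter_le`, `secondMoment_pairs_le`-pattern of
Theorems/OneSliceSingleThresholdCliqueMinusEdgeInvisible.lean, with the FULL clique `Q_A = K_A` in place of
`K_A − e`): `adv² ≤ χ² = E_{A,A'}[ρ^{-e(K_A ∩ K_{A'})}] − 1 ≤ Σ_{j=2}^{k} Pr[|A ∩ A'| = j]·ρ^{-C(j,2)}
≤ Σ_j k^{2j} n^{-j(1 − σ(j−1)/2)} ≤ k·k^{2k}·n^{-(2 − σ(k−1))}` since `σ(j−1)/2 ≤ σ(k−1)/2 < 1`; so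
`c₂ = (2 − σ(k−1))/4` works eventually (every subgraph of `K_k` is strictly supercritical in
`G(n, n^{-σ})` iff `σ < 2/(k−1)`). Used in `rsd_trivial_below_critical`: the dose dial is TRIVIAL (RSD_σ → 0
for every monotone `f`, every background law) below `2/(k−1)`. [folklore; cf. Rossman2010, Lemma 23 (App. B) for the template] -/
theorem stub_doseTrivialBelowCritical :
    ∀ k : ℕ, 3 ≤ k → ∀ σ : ℝ, 0 < σ → σ < 2 / ((k : ℝ) - 1) → ∃ c₂ : ℝ, 0 < c₂ ∧
      ∀ᶠ n : ℕ in atTop, ∀ f : (Edges n → Bool) → Bool,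
        |∑ y : Edges n → Bool, gnpWeight n ((n : ℝ) ^ (-σ)) y *
            (kSubsetProb n k (fun A => f (y ⊔ cliqueVec A) = true) -
              (if f y = true then (1 : ℝ) else 0))| ≤ (n : ℝ) ^ (-c₂) :=
  _root_.Summit.PneNP.PneNP.Theorems.SingleThreshold.stub_doseTrivialBelowCritical

/-- **Stub L — Lemma 13 under the planted law (LANDED p141374,
`Summit.PneNP.PneNP.Theorems.SingleThreshold.stub_plantedApproxError`; calibration of the reduction to
approximators).** For the structural ⋆-closed approximation `ap` (clauses (a)–(c) of stub C at bias
`0 ≤ p ≤ 1`, trigger `0 ≤ t`, classes `K = smallI ∪ medJ`; all valid wires monotone) of a well-formed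
`{∧₂,∨₂}`-program `gs`, the gates disagree with their approximators on the PLANTED input `S ∪ K_A`
(`S ∼ G(n,p)`, `A` a uniform `k`-set) with probability `≤ |gs|·|K|·t` — the same bound as Lemma 13
(`StarApproxInv.err`) for the plain input `S`. Why true: induction over the gates as in
`StarApproxInv.snoc`; the only error source is an `∨̄`-gate `m` whose closure accepts `z = S ∪ K_A` while
the gate value (`= ap u z ∨ ap v z` when all earlier gates agree at `z`) rejects it, i.e. some `h` added in
some round of `clIter` has `h ≤ S ∪ K_A` although the previous iterate `g_i` rejects `S ∪ K_A`; but then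
`S ∪ h ≤ S ∪ K_A`, so by monotonicity `g_i` rejects `S ∪ h` too — an event of `S`-probability
`fails p g_i h ≤ t` (the defining property of added `h`: `prob_clIter_flip_le`/`prob_flip_le_sum` with
`x ⊔ cliqueVec A` for `x`, pointwise in `A`); sum over the `≤ |K|` patterns added per gate
(`sum_card_clNew_le`) and over the gates; finally average over `A` (`kSubsetProb` of a union ≤ sum).
Planting can only make sure patterns surer. Used in `adv_approx_ge`: `adv_q(ap out) ≤ adv_q(C) + |gs|·|K|·t`,
so (with `dom` + Lemma 13) the needle for approximators IS the needle for circuits. [cite: Rossman2010, Lemma 13 (p. 8); this line] -/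
theorem stub_plantedApproxError {n k : ℕ} {p t : ℝ} (hp0 : 0 ≤ p) (hp1 : p ≤ 1) (ht : 0 ≤ t)
    (gs : List (Gate (Edges n))) (ap : Edges n ⊕ ℕ → (Edges n → Bool) → Bool)
    (hwf : GateList.WF gs) (hB : ∀ g ∈ gs, g.fn ∈ monotoneBasis)
    (hinl : ∀ i, ap (Sum.inl i) = fun x => x i)
    (hand : ∀ (m : ℕ) (u v : Edges n ⊕ ℕ), gs[m]? = some (GateList.andGate u v) →
        ap (Sum.inr m) = fun x => ap u x && ap v x)
    (hor : ∀ (m : ℕ) (u v : Edges n ⊕ ℕ), gs[m]? = some (GateList.orGate u v) →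
        ap (Sum.inr m) = starClosure p t (smallI n k ∪ medJ n k) (fun x => ap u x || ap v x))
    (hmono : ∀ w, GateList.OutOK gs.length w → Monotone (ap w)) :
    (∑ x : Edges n → Bool, gnpWeight n p x * kSubsetProb n k (fun A =>
        ∃ m < gs.length, (vals gs (x ⊔ cliqueVec A)).getD m false ≠ ap (Sum.inr m) (x ⊔ cliqueVec A)))
      ≤ gs.length * (#(smallI n k ∪ medJ n k) * t) :=
  _root_.Summit.PneNP.PneNP.Theorems.SingleThreshold.stub_plantedApproxError hp0 hp1 ht gs ap hwf hB
    hinl hand hor hmono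

/-! ## v6 (lead c3, cycle 1): calibration of the needles at small sizes — stub M -/

/-- **Stub M — the needles hold below `n²` gates (LANDED p141207,
`Summit.PneNP.PneNP.Theorems.SingleThreshold.stub_advLeReads`; calibration, lead c3).** For `2 ≤ k ≤ n`, `0 < n`, every background density
`q ∈ [0,1]` and every `{∧₂,∨₂,0,1}`-circuit `D` of size `≤ s` (no monotonicity needed):
`E_{S,A}[D(S ∪ K_A)] − Pr_S[D(S)=1] ≤ (2s+1)(k/n)²`, `S ∼ G(n,q)`, `A` a uniform `k`-set. Why true
(locality): `D(S ∪ K_A) ≠ D(S)` forces some edge READ by `D` (at most `2|D|+1` of them,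
`length_inputList_le`) to lie inside `A` (`eval_congr`), an event of probability `≤ (k/n)²` per edge
(`kSubsetProb_supset_le`). Consequence (`noisyIndist_matrix_le_one`): each of the three needle
matrices (E via `noisyIndist_at`, E′, I) holds for sizes `≤ n^c` with `c ≤ 1` at EVERY density —
the first contentful exponent of the needle is `c = 2` (crux exponent `1`, cf. `Negative/Locality`).
[folklore; this line, lead c3] -/
theorem stub_advLeReads :
    ∀ (n k s : ℕ), k ≤ n → 0 < n → 2 ≤ k → ∀ q : ℝ, 0 ≤ q → q ≤ 1 →
      ∀ D : Circuit (Edges n), D.IsOver monotoneBasis01 → D.size ≤ s →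
        (∑ x : Edges n → Bool, gnpWeight n q x *
            kSubsetProb n k (fun A => D.eval (x ⊔ cliqueVec A) = true)) -
          gnpProb n q (univ.filter fun x => D.eval x = true) ≤ (2 * s + 1) * ((k : ℝ) / n) ^ 2 :=
  _root_.Summit.PneNP.PneNP.Theorems.SingleThreshold.stub_advLeReads

/-- **The needle matrices at exponent `c ≤ 1` (calibration, sorry-free modulo stub M):** for every
background density sequence `q n ∈ [0,1]`, every `k ≥ 2` and every `γ > 0`, eventually all
`{∧₂,∨₂,0,1}`-circuits of size `≤ n^c`, `c ≤ 1`, have noisy-planted advantage `≤ γ`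
(`(2n+1)k²/n² ≤ 3k²/n → 0`). In particular the `∀ᶠ`-matrices of `stub_noisyIndistSparse` (any `β`)
and, via `rsdAdv_le_adv`, of `stub_relativeSparseDose` (any `σ`) hold at `c ≤ 1`. [folklore; lead c3] -/
theorem noisyIndist_matrix_le_one {c : ℕ} (hc : c ≤ 1) (k : ℕ) (hk : 2 ≤ k) (q : ℕ → ℝ)
    (hq0 : ∀ n, 0 ≤ q n) (hq1 : ∀ n, q n ≤ 1) :
    ∀ γ : ℝ, 0 < γ → ∀ᶠ n : ℕ in atTop, ∀ D : Circuit (Edges n), D.IsOver monotoneBasis01 →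
      D.size ≤ n ^ c →
        (∑ x : Edges n → Bool, gnpWeight n (q n) x *
            kSubsetProb n k (fun A => D.eval (x ⊔ cliqueVec A) = true)) -
          gnpProb n (q n) (univ.filter fun x => D.eval x = true) ≤ γ := by
  intro γ hγ
  have hev : ∀ᶠ n : ℕ in atTop, 3 * (k : ℝ) ^ 2 / n ≤ γ := by
    have h1 : Tendsto (fun n : ℕ => 3 * (k : ℝ) ^ 2 / n) atTop (𝓝 0) :=
      tendsto_const_nhds.div_atTop tendsto_natCast_atTop_atTop
    exact h1.eventually (eventually_le_nhds hγ)
  filter_upwards [hev, eventually_ge_atTop (max k 1)] with n hn hnk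
  intro D hD hsize
  have hkn : k ≤ n := le_trans (le_max_left _ _) hnk
  have hn1 : 1 ≤ n := le_trans (le_max_right _ _) hnk
  have hn0 : 0 < n := hn1
  have hnr : (0 : ℝ) < n := by exact_mod_cast hn0
  have hsz : D.size ≤ n := by
    refine hsize.trans ?_
    rcases Nat.le_one_iff_eq_zero_or_eq_one.1 hc with rfl | rfl
    · simp; exact hn1
    · simp
  refine (stub_advLeReads n k n hkn hn0 hk (q n) (hq0 n) (hq1 n) D hD hsz).trans (le_trans ?_ hn)
  -- `(2n+1)(k/n)² ≤ 3k²/n`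
  rw [div_pow, ← mul_div_assoc, div_le_div_iff₀ (by positivity) hnr]
  have h1 : (2 * (n : ℝ) + 1) ≤ 3 * n := by
    have : (1 : ℝ) ≤ n := by exact_mod_cast hn1
    linarith
  have h2 : (0 : ℝ) ≤ (k : ℝ) ^ 2 * n := by positivity
  nlinarith

/-! ## Composition III (sorry-free): the crux from the fixed-density needle I via H and A -/

/-- `n ^ c + 1 ≤ n ^ (c + 1)` for `n ≥ 2` (one extra gate is absorbed by one extra power). [folklore] -/
theorem pow_add_one_le_pow_succ' {n c : ℕ} (hn2 : 2 ≤ n) : n ^ c + 1 ≤ n ^ (c + 1) := by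
  have h1 : 1 ≤ n ^ c := Nat.one_le_pow _ _ (by omega)
  calc n ^ c + 1 ≤ n ^ c + n ^ c := Nat.add_le_add_left h1 _
    _ = n ^ c * 2 := (Nat.mul_two _).symm
    _ ≤ n ^ c * n := Nat.mul_le_mul_left _ hn2
    _ = n ^ (c + 1) := (Nat.pow_succ _ _).symm

/-- **`SingleThreshold` from the fixed-density needle** (kernel-checked glue): NoisyIndistSparse at
exponent `c + 2` (stub I) ⟹ by background monotonicity (stub H, with `q_b = n^{-β} ≤ q = pMinus k 1 n`
because `4/(k−1) ≤ β`, and `q_a = (q − q_b)/(1 − q_b) ∈ [0,1]`, `q_a ⊕ q_b = q`) NoisyIndist`(c+1, k, 1)`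
for every `k ≥ max(k₀, 5, ⌈4/β⌉ + 1)` ⟹ (stub A, the landed two-round transfer) the crux at `c`.
[folklore; this line, lead c1] -/
theorem SingleThreshold_of_nis : Summit.PneNP.PneNP.Theses.OneSlice.SingleThreshold := by
  intro c
  obtain ⟨β, hβ, k₀, hk₀⟩ := stub_noisyIndistSparse (c + 2)
  set k : ℕ := max (max k₀ 5) (⌈4 / β⌉₊ + 1) with hkdef
  have hk5 : 5 ≤ k := le_trans (le_max_right _ _) (le_max_left _ _)
  have hkk₀ : k₀ ≤ k := le_trans (le_max_left _ _) (le_max_left _ _)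
  have hk1 : (0 : ℝ) < (k : ℝ) - 1 := by
    have : (5 : ℝ) ≤ k := by exact_mod_cast hk5
    linarith
  have hkβ : 4 / ((k : ℝ) - 1) ≤ β := by
    have h1 : (⌈4 / β⌉₊ + 1 : ℕ) ≤ k := le_max_right _ _
    have h3 : ((⌈4 / β⌉₊ : ℕ) : ℝ) + 1 ≤ k := by exact_mod_cast h1
    have h2 : (4 / β : ℝ) ≤ ⌈4 / β⌉₊ := Nat.le_ceil _
    rw [div_le_iff₀ hk1]
    have h4 : 4 / β ≤ (k : ℝ) - 1 := by linarith
    rw [div_le_iff₀ hβ] at h4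
    linarith
  have hNI : ∀ γ : ℝ, 0 < γ → ∀ᶠ n : ℕ in atTop, ∀ D : Circuit (Edges n),
      D.IsOver monotoneBasis01 → D.size ≤ n ^ (c + 1) →
        (∑ x : Edges n → Bool, gnpWeight n (pMinus k 1 n) x *
            kSubsetProb n k (fun A => D.eval (x ⊔ cliqueVec A) = true)) -
          gnpProb n (pMinus k 1 n) (univ.filter fun x => D.eval x = true) ≤ γ := by
    intro γ hγ
    filter_upwards [hk₀ k hkk₀ γ hγ, eventually_ge_atTop 2] with n hn hn2
    intro D hD hsize
    have hnr : (1 : ℝ) < n := by exact_mod_cast hn2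
    have hnr' : (0 : ℝ) < n := by linarith
    have hqb0 : 0 < (n : ℝ) ^ (-β) := Real.rpow_pos_of_pos hnr' _
    have hqb1 : (n : ℝ) ^ (-β) < 1 := Real.rpow_lt_one_of_one_lt_of_neg hnr (by linarith)
    have hq1 : pMinus k 1 n ≤ 1 :=
      Real.rpow_le_one_of_one_le_of_nonpos hnr.le
        (div_nonpos_of_nonpos_of_nonneg (by norm_num) hk1.le)
    have hqbq : (n : ℝ) ^ (-β) ≤ pMinus k 1 n := by
      have h1 : -(2 * (1 + 1)) / ((k : ℝ) - 1) = -(4 / ((k : ℝ) - 1)) := by ring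
      have h2 : -β ≤ -(2 * (1 + 1)) / ((k : ℝ) - 1) := by rw [h1]; linarith
      exact Real.rpow_le_rpow_of_exponent_le hnr.le h2
    set q : ℝ := pMinus k 1 n with hq
    set qb : ℝ := (n : ℝ) ^ (-β) with hqb
    set qa : ℝ := (q - qb) / (1 - qb) with hqa
    have h1qb : 0 < 1 - qb := by linarith
    have hqa0 : 0 ≤ qa := div_nonneg (by linarith) h1qb.le
    have hqa1 : qa ≤ 1 := by rw [div_le_one h1qb]; linarith
    have hcomb : qa + qb - qa * qb = q := by
      have : qa * (1 - qb) = q - qb := div_mul_cancel₀ _ h1qb.ne'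
      linear_combination this
    rw [← hcomb]
    refine stub_backgroundMonotone (s := n ^ (c + 1)) hqa0 hqa1
      (fun D' hD' hsize' => hn D' hD' (hsize'.trans (pow_add_one_le_pow_succ' hn2))) D hD hsize
  obtain ⟨δ, hδ, h⟩ := stub_twoRoundTransfer c k 1 hk5 one_pos hNI
  exact ⟨k, by omega, δ, hδ, h⟩

/-! ## v6.2 (lead c3, cycle 1): the needle in its cleanest costume and the exponent-exact lever — stubs A′, N -/

/-- **Stub A′ — the two-round transfer at sharp size (LANDED p142224,
`Summit.PneNP.PneNP.Theorems.SingleThreshold.stub_twoRoundTransferSharp`; lead c3).** For `k ≥ 5`, `ε > 0` and ANY size function `s`: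
NoisyIndist for monotone01 circuits of size `≤ s n + 1` at the sprinkle density `pMinus k ε n`
implies `∃ δ > 0 ∀ᶠ n ∀ C` monotone, `err_p(C) ≤ δ → s n < |C|`. Verbatim the landed proof of stub A
(`adv_lower_bound`, `adv_union_le`: the restrictions `C^{H'}` have at most ONE more gate), with the
size step sharpened from `n^c + 1 ≤ n^{c+1}` to `|C| + 1 ≤ s n + 1`. Point: the crux at its first open
exponent `c = 2` follows from NoisyIndist for circuits of size `≤ n² + 1` — linear in the number of
inputs — while below `n²/k²` gates NoisyIndist holds by locality (stub M). [cite: Rossman2010, §7 and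
App. B (pp. 10, 13–14); this line] -/
theorem stub_twoRoundTransferSharp :
    ∀ (k : ℕ) (ε : ℝ) (s : ℕ → ℕ), 5 ≤ k → 0 < ε →
      (∀ γ : ℝ, 0 < γ →
      ∀ᶠ n : ℕ in atTop, ∀ D : Circuit (⊤ : SimpleGraph (Fin n)).edgeSet,
        D.IsOver monotoneBasis01 → D.size ≤ s n + 1 →
          (∑ x : ((⊤ : SimpleGraph (Fin n)).edgeSet → Bool),
              gnpWeight n (pMinus k ε n) x *
                kSubsetProb n k (fun A => D.eval (x ⊔ cliqueVec A) = true)) -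
            gnpProb n (pMinus k ε n) (univ.filter fun x => D.eval x = true) ≤ γ) →
      ∃ δ : ℝ, 0 < δ ∧ ∀ᶠ n : ℕ in Filter.atTop,
        ∀ C : Literature.Computability.Complexity.Circuit ((⊤ : SimpleGraph (Fin n)).edgeSet),
          C.IsOver Literature.Computability.Complexity.monotoneBasis →
            (Finset.univ.filter (fun x : ((⊤ : SimpleGraph (Fin n)).edgeSet) → Bool =>
                C.eval x ≠ decide (¬ (SimpleGraph.fromEdgeSet {e : Sym2 (Fin n) |
                  ∃ h : e ∈ (⊤ : SimpleGraph (Fin n)).edgeSet, x ⟨e, h⟩ = true}).CliqueFree k))).sum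
              (fun x => ((n : ℝ) ^ (-(2 : ℝ) / ((k : ℝ) - 1))) ^ (Finset.univ.filter (fun e => x e = true)).card *
                (1 - (n : ℝ) ^ (-(2 : ℝ) / ((k : ℝ) - 1))) ^
                  (n.choose 2 - (Finset.univ.filter (fun e => x e = true)).card)) ≤ δ →
            s n < C.size :=
  _root_.Summit.PneNP.PneNP.Theorems.SingleThreshold.stub_twoRoundTransferSharp

/-- **Stub N — NoisyIndist, exponent-exact (OPEN — the NEEDLE in its cleanest costume; lead c3).**
For every exponent `c` there is `k₀` such that for all `k ≥ k₀` and all small `ε > 0`: for every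
`γ > 0`, eventually in `n`, every monotone `{∧₂,∨₂,0,1}`-circuit `D` with `|D| ≤ n^c + 1` satisfies
`E_{S,A}[D(S ∪ K_A)] − Pr_S[D(S) = 1] ≤ γ`, `S ∼ G(n, pMinus k ε n)` (the just-subcritical
sprinkle), `A` a uniform `k`-set: A PLANTED `k`-CLIQUE IS INVISIBLE TO SMALL MONOTONE CIRCUITS ON THE
SUBCRITICAL BACKGROUND. Relations (all kernel-checked in this file): stub E ⟹ N
(`noisyIndist_of_descentSplit`, via `NoisyIndistStrong_of` at exponent `c + 1`); N ⟹ the crux at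
the SAME exponent (`SingleThreshold_of_noisyIndist`, stub A′ with `s n = n^c`); N ⟹ E′
(`rsdAdv_le_adv`); N at `c = 2` (size `≤ n² + 1`) is the first open instance —
`stub_advLeReads` gives N's matrix only for sizes `o(n²/k²)`. Why plausibly true / why
hard: see stubs E, E′ and `Cruxes/SingleThreshold/NeedleAnalysis-c3.md` ((H1)–(H5)): every available
handle (subadditivity, path-free pair-leak, Rossman's medium-minterm counting with noisy positives)
stops at size `≈ n²`; in restriction form N says that a `μ_q`-random complete restriction outside a
random `k`-clique's edge set leaves every size-`n^c` monotone circuit constant w.h.p. — Rossman's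
single-threshold problem (FOCS'10 §9). [cite: Rossman2010, §9 (p. 11); this line] -/
theorem stub_noisyIndist :
    ∀ c : ℕ, ∃ k₀ : ℕ, ∀ k : ℕ, k₀ ≤ k → ∃ ε₀ : ℝ, 0 < ε₀ ∧ ∀ ε : ℝ, 0 < ε → ε ≤ ε₀ →
      ∀ γ : ℝ, 0 < γ →
      ∀ᶠ n : ℕ in atTop, ∀ D : Circuit (Edges n),
        D.IsOver monotoneBasis01 → D.size ≤ n ^ c + 1 →
          (∑ x : Edges n → Bool, gnpWeight n (pMinus k ε n) x *
                kSubsetProb n k (fun A => D.eval (x ⊔ cliqueVec A) = true)) -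
            gnpProb n (pMinus k ε n) (univ.filter fun x => D.eval x = true) ≤ γ := by
  sorry

/-- **Stub E ⟹ stub N** (sorry-free modulo E): NoisyIndist in the strong form at exponent `c + 1`
(`NoisyIndistStrong_of`) covers size `n^c + 1 ≤ n^{c+1}` (`n ≥ 2`). [folklore; lead c3] -/
theorem noisyIndist_of_descentSplit :
    ∀ c : ℕ, ∃ k₀ : ℕ, ∀ k : ℕ, k₀ ≤ k → ∃ ε₀ : ℝ, 0 < ε₀ ∧ ∀ ε : ℝ, 0 < ε → ε ≤ ε₀ →
      ∀ γ : ℝ, 0 < γ →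
      ∀ᶠ n : ℕ in atTop, ∀ D : Circuit (Edges n),
        D.IsOver monotoneBasis01 → D.size ≤ n ^ c + 1 →
          (∑ x : Edges n → Bool, gnpWeight n (pMinus k ε n) x *
                kSubsetProb n k (fun A => D.eval (x ⊔ cliqueVec A) = true)) -
            gnpProb n (pMinus k ε n) (univ.filter fun x => D.eval x = true) ≤ γ := by
  intro c
  obtain ⟨k₀, hk₀⟩ := NoisyIndistStrong_of (c + 1)
  refine ⟨k₀, fun k hk => ?_⟩
  obtain ⟨ε₀, hε₀, hN⟩ := hk₀ k hk
  refine ⟨ε₀, hε₀, fun ε hε0 hεle γ hγ => ?_⟩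
  filter_upwards [hN ε hε0 hεle γ hγ, eventually_ge_atTop 2] with n hn hn2
  intro D hD hsize
  exact hn D hD (hsize.trans (pow_add_one_le_pow_succ' hn2))

/-- **Stub N ⟹ stub E′** (sorry-free modulo N): the relative sparse-dose advantage is at most the
plain advantage (`rsdAdv_le_adv`), at any dose exponent, e.g. `σ = 2 + 1/(k−1)`; size `n^c ≤ n^c + 1`.
So the implication web of the needle costumes is `E ⟹ N ⟹ E′` (this file) and `I ⟹ crux`
(`SingleThreshold_of_nis`), `N ⟹ crux` (`SingleThreshold_of_noisyIndist`), `E′ ⟹ crux`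
(`SingleThreshold_of`). [folklore; lead c3] -/
theorem relativeSparseDose_of_noisyIndist :
    ∀ c : ℕ, ∃ k₀ : ℕ, ∀ k : ℕ, k₀ ≤ k → ∃ ε₀ : ℝ, 0 < ε₀ ∧ ∀ ε : ℝ, 0 < ε → ε ≤ ε₀ →
      ∃ σ : ℝ, 1 + 1 / ((k : ℝ) - 1) < σ ∧ ∀ γ : ℝ, 0 < γ →
      ∀ᶠ n : ℕ in atTop, ∀ D : Circuit (Edges n),
        D.IsOver monotoneBasis01 → D.size ≤ n ^ c →
          (∑ x : Edges n → Bool, gnpWeight n (pMinus k ε n) x *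
                kSubsetProb n k (fun A => D.eval (x ⊔ cliqueVec A) = true)) -
            (∑ x : Edges n → Bool, ∑ y : Edges n → Bool,
                gnpWeight n (pMinus k ε n) x * gnpWeight n ((n : ℝ) ^ (-σ)) y *
                  (if D.eval (x ⊔ y) = true then (1 : ℝ) else 0)) ≤ γ := by
  intro c
  obtain ⟨k₀, hk₀⟩ := stub_noisyIndist c
  refine ⟨max k₀ 5, fun k hk => ?_⟩
  have hk5 : 5 ≤ k := le_trans (le_max_right _ _) hk
  obtain ⟨ε₀, hε₀, hN⟩ := hk₀ k (le_trans (le_max_left _ _) hk)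
  refine ⟨ε₀, hε₀, fun ε hε0 hεle => ⟨2 + 1 / ((k : ℝ) - 1), by linarith, fun γ hγ => ?_⟩⟩
  have hk1 : (0 : ℝ) < (k : ℝ) - 1 := by
    have : (5 : ℝ) ≤ k := by exact_mod_cast hk5
    linarith
  filter_upwards [hN ε hε0 hεle γ hγ, eventually_ge_atTop 1] with n hn hn1
  intro D hD hsize
  have hnr : (1 : ℝ) ≤ n := by exact_mod_cast hn1
  have hq0 : 0 ≤ pMinus k ε n := Real.rpow_nonneg (by linarith) _
  have hq1 : pMinus k ε n ≤ 1 :=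
    Real.rpow_le_one_of_one_le_of_nonpos hnr
      (div_nonpos_of_nonpos_of_nonneg (by nlinarith) hk1.le)
  have hσ0 : (0 : ℝ) < 2 + 1 / ((k : ℝ) - 1) := by positivity
  have hρ0 : 0 ≤ (n : ℝ) ^ (-(2 + 1 / ((k : ℝ) - 1))) := Real.rpow_nonneg (by linarith) _
  have hρ1 : (n : ℝ) ^ (-(2 + 1 / ((k : ℝ) - 1))) ≤ 1 :=
    Real.rpow_le_one_of_one_le_of_nonpos hnr (by linarith)
  exact (rsdAdv_le_adv hq0 hq1 hρ0 hρ1 D hD).trans (hn D hD (Nat.le_succ_of_le hsize))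

/-- **`SingleThreshold` from the needle N at the SAME exponent** (kernel-checked glue): stub A′ with
`s n = n^c` applied to stub N at `c`, `k = max k₀ 5`, `ε = ε₀`. [folklore; lead c3] -/
theorem SingleThreshold_of_noisyIndist : Summit.PneNP.PneNP.Theses.OneSlice.SingleThreshold := by
  intro c
  obtain ⟨k₀, hk₀⟩ := stub_noisyIndist c
  have hk5 : 5 ≤ max k₀ 5 := le_max_right _ _
  obtain ⟨ε₀, hε₀, hN⟩ := hk₀ (max k₀ 5) (le_max_left _ _)
  obtain ⟨δ, hδ, h⟩ := stub_twoRoundTransferSharp (max k₀ 5) ε₀ (fun n => n ^ c) hk5 hε₀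
    (hN ε₀ hε₀ le_rfl)
  exact ⟨max k₀ 5, by omega, δ, hδ, h⟩

/-! ## Composition II (sorry-free): the crux from the stubs -/

/-- **`SingleThreshold` from the dial** (kernel-checked glue, the registered composition): the dose
transfer (stub F) applied at `c + 1` to the weak needle `stub_relativeSparseDose` (stub E′) and the
sprinkle bound (stub G). [folklore] -/
theorem SingleThreshold_of : Summit.PneNP.PneNP.Theses.OneSlice.SingleThreshold := by
  intro c
  obtain ⟨k₀, hk₀⟩ := stub_relativeSparseDose (c + 1)
  have hk5 : 5 ≤ max k₀ 5 := le_max_right _ _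
  obtain ⟨ε₀, hε₀, hE⟩ := hk₀ (max k₀ 5) (le_max_left _ _)
  obtain ⟨σ, hσ, hRSD⟩ := hE ε₀ hε₀ le_rfl
  obtain ⟨δ, hδ, h⟩ := stub_doseTransfer c (max k₀ 5) ε₀ σ hk5 hε₀ hσ hRSD
    (stub_gnpTVSprinkle (max k₀ 5) (by omega) σ hσ)
  exact ⟨max k₀ 5, by omega, δ, hδ, h⟩

/-- **`SingleThreshold` from the strong needle** (kernel-checked glue): the original composition —
the two-round transfer (stub A, landed) applied at `c + 1` to NoisyIndist (`NoisyIndist_of`, stubs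
B–D landed + stub E). [folklore] -/
theorem SingleThreshold_of_descentSplit : Summit.PneNP.PneNP.Theses.OneSlice.SingleThreshold := by
  intro c
  obtain ⟨k, hk, ε, hε, hN⟩ := NoisyIndist_of (c + 1)
  obtain ⟨δ, hδ, h⟩ := stub_twoRoundTransfer c k ε hk hε hN
  exact ⟨k, le_trans (by norm_num) hk, δ, hδ, h⟩

end Summit.PneNP.PneNP.Cruxes.SingleThreshold.TwoRoundExposure

end
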